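import Literature.AlgebraicGeometry.Resolution.PointBlowupShade
import Mathlib

/-!
# Giraud's normal form of a function on a surface in characteristic `p` — statement-level typing

Source: J. Giraud, *Forme normale d'une fonction sur une surface de caractéristique positive*,
Bull. Soc. Math. France **111** (1983) 109–124 [cite: Giraud1983, §1.1–1.3, §2.1–2.4, Rem. 2.7].

For a regular scheme `X` of characteristic `p > 0` with `Ω¹_X` locally free of finite rank, a function `f`
and a normal-crossings divisor `E`, Giraud defines (1.1 (2)) the ideal `J(X,f,E)` — "annulateur du morphisme
`𝒪_X → Ω¹_X(E)`, `u ↦ u·df`"; in differential coordinates with `E = div(x^a)` it "est engendré par les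
`x_i ∂f/∂x_i` avec `a(i) ≠ 0` et les `∂f/∂x_j` avec `a(j) = 0`" —, the zero locus
`E(f) = {ξ : df ∈ 𝔪_ξ Ω¹_ξ} = (Spec 𝒪_X/J(X,f))_red` (1.2 (1)), and the two conditions
"(*) `E(f)` est un diviseur à croisements normaux; (**) `E(f)` est un diviseur à croisements normaux et
`J(X,f,E(f))` est l'idéal d'un diviseur à croisements normaux" (1.2); by Prop. 1.5, (**) means that étale-locally
`f = g^p + x^a·u`.  On a surface (§2), for a non-zero ideal `I` with bidual (invertible hull) `B(I)` he sets
`D(I) = I·B(I)⁻¹`, `m(I,ξ) = ord_ξ D(I)`, `c(I,ξ) = long(𝒪_ξ / D(I)𝒪_ξ)` (2.1 (2)–(3)) — "ces deux nombres ne changent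
pas si l'on multiplie `I` par un idéal inversible" —, proves the blow-up inequality
`Σ_{ξ'} [k(ξ'):k(ξ)]·c(I',ξ') ≤ c(I,ξ) − m(m+1)/2` for `I' = I𝒪_{X'}` (Lemma 2.1.1), applies it to `J(X,ω,E(ω))`
of a 1-form `ω` (2.2, Lemma 2.3: at a crossing point of `E(ω)` the same bound, at a non-crossing point
`[k(ξ'):k(ξ)]·c' ≤ c − m(m−1)/2`, and for `ω = df` the equality `c' = c` forces `m = 1`), and concludes
(Thm. 2.4) that for `f` not a `p`-th power, blowing up successively the finite sets `Sing(X_{n−1}, df_{n−1})`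
(the closed points where `c ≠ 0`) reaches (**) after finitely many steps.  Rem. 2.7 records the
non-logarithmic twin `J(X,ω)` = ideal of coefficients, `μ = m(J(X,ω),ξ)`, `χ = c(J(X,ω),ξ)`, `RSing = {χ ≠ 0}`.

THIS FILE types these objects for the local model used by the resolution observatory's atlas (unit
`pub-rosobs`, dictionary D11 — a DERIVED reading documented in the atlas, never cited as a theorem): the
affine plane `K[y,z] = MvPolynomial (Fin 2) K` at the ORIGIN, a 1-form given by its two coefficients, the
divisor `E` among the coordinate AXES (the exceptional curves of the walk are axes of the chart), orders via
`Hauser2010.ordZero`, colengths at the origin via `Module.length` of the quotients by `I + 𝔪^{N+1}`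
(stationary value), the finite part of a two-generated ideal via a gcd in the UFD `K[y,z]`.  Typed:
`coeffIdeal` (`J(X,ω)`), `logJacobianGens` / `logJacobianIdeal` (`J(X,dF,E)` for `E` ⊆ axes, 1.1),
`finitePartGens` (`D` of a pair, 2.1), `mPair` / `cPair` (2.1 (3)), `mu` / `chi` (Rem. 2.7), `mLog` / `cLog`,
`StarAxesAt0` ((*) at the origin with the components of `E(dF)` through it required to be the axes in `E`),
`DoubleStarAxesAt0` ((**) = (*) and `c = 0`, using 1.3: `(Spec 𝒪/J(X,f,E(f)))_red = E(f)`), the total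
transform `totalChart j F = F ∘ e_j` of a point blow-up (= `chartTransform 0 j`), and the NAMED statements
`Lemma211Statement` (blow-up inequality for a two-generated ideal at the origin, over an algebraically closed
field so that all points of the exceptional curve are rational and the residue degrees are `1`) and
`BlowupDropsStatement` (Lemma 2.3 (i) for `ω = dF` at a crossing point of axes).  They are `Prop`s carrying
the citation, used downstream as hypotheses — NOT proved here (named-fact debt, recorded in the atlas).

PROVED here (elementary, the load-bearing identities of dictionary D11): in characteristic `p`,
`∂_i(G^p) = 0` (`pderiv_pow_char_eq_zero`), hence the differential `dF` is unchanged by the atlas' cleaning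
`F ↦ F + G^p` (`pderiv_add_pow_char`) and `∂_i(y_j^{p} · G) = y_j^{p} · ∂_i G` (`pderiv_X_pow_char_mul`):
Giraud's total transform `f ∘ e` and the atlas' strict transform `y_j^{-p}·(f ∘ e)` have log-Jacobian ideals
differing by the invertible ideal `(y_j^p)`, so `m` and `c` (2.1: invariant under multiplication by an
invertible ideal) are functions of the atlas state.

Conventions / junk values: `ordZero 0 = ⊤`; `cPair a b = ⊤` when the finite part is not `𝔪`-primary free
at the origin cannot happen for a coprime pair — for the zero pair the gcd is `0` and the cofactors are
junk (documented at `finitePartGens`); `Module.length` is `ℕ∞`-valued.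
-/

open MvPolynomial Finset

open scoped BigOperators

noncomputable section

namespace Literature.AlgebraicGeometry.Resolution.Giraud1983

open Literature.AlgebraicGeometry.Resolution.Hauser2010 (ordZero)
open Literature.AlgebraicGeometry.Resolution.PointBlowup (chartTransform translate)

variable (K : Type*) [Field K]

/-- the coordinate ring `K[y,z]` of the chart (`y = X 0`, `z = X 1`). [folklore] -/
abbrev A : Type _ := MvPolynomial (Fin 2) K

/-- the maximal ideal `𝔪 = (y, z)` of the origin of the chart. [folklore] -/
def origin : Ideal (A K) := Ideal.span {X 0, X 1}

variable {K}

/-- a 1-form `ω = a·dy + b·dz` on the chart, recorded by its two coefficients. [cite: Giraud1983, §2.2] -/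
structure OneForm (K : Type*) [Field K] where
  /-- coefficient of `dy` -/
  a : A K
  /-- coefficient of `dz` -/
  b : A K

/-- the exact form `dF = F_y dy + F_z dz`. [cite: Giraud1983, §1.1 (2)] -/
def dOf (F : A K) : OneForm K := ⟨pderiv 0 F, pderiv 1 F⟩

/-- `J(X, ω)`: the ideal of coefficients of `ω` (the case `E = ∅` of 1.1, Rem. 2.7 "l'idéal … engendré par les
coordonnées `a` et `b` de `ω`"). [cite: Giraud1983, Rem. 2.7] -/
def coeffIdeal (ω : OneForm K) : Ideal (A K) := Ideal.span {ω.a, ω.b}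

/-- generators of the logarithmic Jacobian ideal `J(X, ω, E)` for `E` a set of coordinate AXES through the origin:
`x_i·(coefficient of dx_i)` for `i ∈ E`, the bare coefficient for `i ∉ E` ("engendré par les `x_i ∂f/∂x_i` avec
`a(i) ≠ 0` et les `∂f/∂x_j` avec `a(j) = 0`"). [cite: Giraud1983, §1.1 (after (2))] -/
def logJacobianGens (E : Finset (Fin 2)) (ω : OneForm K) : A K × A K :=
  ((if (0 : Fin 2) ∈ E then X 0 else 1) * ω.a, (if (1 : Fin 2) ∈ E then X 1 else 1) * ω.b)

/-- `J(X, ω, E)` for `E` ⊆ axes. [cite: Giraud1983, §1.1 (2)] -/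
def logJacobianIdeal (E : Finset (Fin 2)) (ω : OneForm K) : Ideal (A K) :=
  Ideal.span {(logJacobianGens E ω).1, (logJacobianGens E ω).2}

/-- a gcd of the pair in the UFD `K[y,z]` (a generator of the bidual = invertible hull `B(I)` of `I = (a, b)`,
2.1 (1)); defined up to a unit, which does not affect the ideals below. [cite: Giraud1983, §2.1 (1)] -/
def gcdPair (a b : A K) : A K := by
  classical
  letI : GCDMonoid (A K) := UniqueFactorizationMonoid.toGCDMonoid (A K)
  exact gcd a b

/-- the chosen gcd divides the first generator. [folklore] -/
theorem gcdPair_dvd_left (a b : A K) : gcdPair a b ∣ a := by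
  classical
  letI : GCDMonoid (A K) := UniqueFactorizationMonoid.toGCDMonoid (A K)
  exact gcd_dvd_left a b

/-- the chosen gcd divides the second generator. [folklore] -/
theorem gcdPair_dvd_right (a b : A K) : gcdPair a b ∣ b := by
  classical
  letI : GCDMonoid (A K) := UniqueFactorizationMonoid.toGCDMonoid (A K)
  exact gcd_dvd_right a b

/-- generators of the FINITE PART `D(I) = I·B(I)⁻¹` of `I = (a, b)`: the cofactors of a gcd (for `a = b = 0` the
gcd is `0` and the cofactors are unspecified junk — the zero form has no finite part). [cite: Giraud1983, §2.1 (2)] -/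
def finitePartGens (a b : A K) : A K × A K :=
  (Classical.choose (gcdPair_dvd_left a b), Classical.choose (gcdPair_dvd_right a b))

/-- `gcd · (first cofactor) = a`. [folklore] -/
theorem gcdPair_mul_finitePartGens_fst (a b : A K) : gcdPair a b * (finitePartGens a b).1 = a :=
  (Classical.choose_spec (gcdPair_dvd_left a b)).symm

/-- `gcd · (second cofactor) = b`. [folklore] -/
theorem gcdPair_mul_finitePartGens_snd (a b : A K) : gcdPair a b * (finitePartGens a b).2 = b :=
  (Classical.choose_spec (gcdPair_dvd_right a b)).symm

/-- `D(I)` as an ideal, `I = (a, b)`. [cite: Giraud1983, §2.1 (2)] -/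
def finitePart (a b : A K) : Ideal (A K) := Ideal.span {(finitePartGens a b).1, (finitePartGens a b).2}

/-- colength at the origin of an ideal `I ⊆ K[y,z]`: the stationary value of `long(K[y,z]/(I + 𝔪^{N+1}))`
(= `long(𝒪_0 / I𝒪_0)` when this is finite, `⊤` when the origin lies on a curve of `V(I)`). [cite: Giraud1983, §2.1 (3)] -/
def colengthAtOrigin (I : Ideal (A K)) : ℕ∞ :=
  ⨆ N : ℕ, Module.length (A K) ((A K) ⧸ (I ⊔ origin K ^ (N + 1)))

/-- `m(I, 0) = ord_0 D(I)` for `I = (a, b)`: the order at the origin of the finite part (minimum over the two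
generators). [cite: Giraud1983, §2.1 (3)] -/
def mPair (a b : A K) : ℕ∞ := min (ordZero (finitePartGens a b).1) (ordZero (finitePartGens a b).2)

/-- `c(I, 0) = long(𝒪_0 / D(I)𝒪_0)` for `I = (a, b)`. [cite: Giraud1983, §2.1 (3)] -/
def cPair (a b : A K) : ℕ∞ := colengthAtOrigin (finitePart a b)

/-- `μ = m(J(X,ω), 0)`: order of the reduced form at the origin. [cite: Giraud1983, Rem. 2.7] -/
def mu (ω : OneForm K) : ℕ∞ := mPair ω.a ω.b

/-- `χ = c(J(X,ω), 0)`; `RSing(X, ω) = {χ ≠ 0}`. [cite: Giraud1983, Rem. 2.7] -/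
def chi (ω : OneForm K) : ℕ∞ := cPair ω.a ω.b

/-- `ξ ∈ RSing(X, ω)` at the origin. [cite: Giraud1983, Rem. 2.7] -/
def InRSing (ω : OneForm K) : Prop := chi ω ≠ 0

/-- `m(X, ω, 0) = m(J(X,ω,E), 0)` for `E` ⊆ axes. [cite: Giraud1983, §2.2] -/
def mLog (E : Finset (Fin 2)) (ω : OneForm K) : ℕ∞ := mPair (logJacobianGens E ω).1 (logJacobianGens E ω).2

/-- `c(X, ω, 0) = c(J(X,ω,E), 0)` for `E` ⊆ axes; `Sing(X, ω) = {c ≠ 0}`. [cite: Giraud1983, §2.2] -/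
def cLog (E : Finset (Fin 2)) (ω : OneForm K) : ℕ∞ := cPair (logJacobianGens E ω).1 (logJacobianGens E ω).2

/-- a component of the zero divisor `E(ω)` through the origin: an irreducible `q` vanishing at `0` and dividing
both coefficients (`E(f) = (Spec 𝒪/J(X,f))_red`). [cite: Giraud1983, §1.2 (1)] -/
def IsZeroDivisorBranch (ω : OneForm K) (q : A K) : Prop :=
  Irreducible q ∧ constantCoeff q = 0 ∧ q ∣ ω.a ∧ q ∣ ω.b

/-- condition (*) AT THE ORIGIN in the axis model: the components of `E(ω)` through the origin are exactly the
axes `y_i = 0`, `i ∈ E` (a normal-crossings divisor there), and `E(ω)` does pass through the origin as a divisor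
unless `ω(0) ≠ 0` — "(*) `E(f)` est un diviseur à croisements normaux", read locally. [cite: Giraud1983, §1.2 (*)] -/
def StarAxesAt0 (E : Finset (Fin 2)) (ω : OneForm K) : Prop :=
  (∀ i ∈ E, X i ∣ ω.a ∧ X i ∣ ω.b) ∧
  (∀ q : A K, IsZeroDivisorBranch ω q → ∃ i ∈ E, Associated q (X i)) ∧
  (E = ∅ → ¬ (constantCoeff ω.a = 0 ∧ constantCoeff ω.b = 0))

/-- condition (**) AT THE ORIGIN in the axis model: (*) and the finite part of `J(X,ω,E(ω))` is trivial there
(`c = 0`), i.e. `J(X,ω,E(ω))` is locally the ideal of a normal-crossings divisor (its divisorial part is supported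
on `E(ω)` by 1.3). [cite: Giraud1983, §1.2 (**), §1.3] -/
def DoubleStarAxesAt0 (E : Finset (Fin 2)) (ω : OneForm K) : Prop :=
  StarAxesAt0 E ω ∧ cLog E ω = 0

/-- `0 ∈ Sing(X, ω)`: (*) holds and `c(X, ω, 0) ≠ 0` — the points blown up by the procedure of Thm. 2.4.
[cite: Giraud1983, §2.2, Thm. 2.4] -/
def InSing (E : Finset (Fin 2)) (ω : OneForm K) : Prop :=
  StarAxesAt0 E ω ∧ cLog E ω ≠ 0

/-- the origin is a CROSSING POINT of `E` (two axes). [cite: Giraud1983, Lemma 2.3] -/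
def IsCrossingPoint (E : Finset (Fin 2)) : Prop := E = Finset.univ

/-- TOTAL transform of `F` under the point blow-up of the origin, chart `y_j` (`y_i ↦ y_i y_j` for `i ≠ j`):
`F ∘ e_j`, i.e. `chartTransform` with no division (`q = 0`); Giraud pulls back the FUNCTION (`f' = f ∘ e`, §1 end,
Thm. 2.4 `f_n = f_{n-1} ∘ e_n`). [cite: Giraud1983, Thm. 2.4] -/
def totalChart (j : Fin 2) (F : A K) : A K := chartTransform 0 j F

/-- pull-back of a 1-form under the chart `y_j` of the point blow-up (`ω' = e^*(ω)`, 2.2): chart `y` (`j = 0`):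
`(y, z) ↦ (y, yz)`, `a' = a∘e + z·(b∘e)`, `b' = y·(b∘e)`; chart `z`: `a' = z·(a∘e)`, `b' = b∘e + y·(a∘e)`.
[cite: Giraud1983, §2.2 (ω' = e^*(ω))] -/
def pullbackChart (j : Fin 2) (ω : OneForm K) : OneForm K :=
  if j = 0 then ⟨totalChart 0 ω.a + X 1 * totalChart 0 ω.b, X 0 * totalChart 0 ω.b⟩
  else ⟨X 1 * totalChart 1 ω.a, totalChart 1 ω.b + X 0 * totalChart 1 ω.a⟩

/-- the 1-form seen at the point `t` of the exceptional curve in chart `y_j` (translate the other coordinate by `t`).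
[cite: Giraud1983, §2.2] -/
def formAtPoint (j : Fin 2) (t : K) (ω : OneForm K) : OneForm K :=
  let b : Fin 2 → K := fun i => if i = j then 0 else t
  ⟨translate b (pullbackChart j ω).a, translate b (pullbackChart j ω).b⟩

/-- **Giraud's blow-up inequality for a two-generated ideal (Lemma 2.1.1), local model.**  Over an ALGEBRAICALLY
CLOSED field (all closed points of the exceptional curve `E ≅ ℙ¹` are rational, residue degrees `1`): for
`I = (a, b) ⊆ K[y,z]` with `c(I,0) < ⊤` and `I' = I·𝒪_{X'}`, the sum over the points of `E` — the points `(0,t)` of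
chart `y` and the origin of chart `z` — of `c(I', ξ')` is at most `c(I,0) − m(m+1)/2`, `m = m(I,0)` (stated multiplied by `2`, no truncated subtraction; `∑ᶠ` is the
finite sum over the finitely many points with `c ≠ 0`).
Named statement (hypothesis downstream), not proved here. [cite: Giraud1983, Lemma 2.1.1] -/
def Lemma211Statement (K : Type*) [Field K] [IsAlgClosed K] : Prop :=
  ∀ a b : A K, cPair a b ≠ ⊤ →
    (∑ᶠ t : K, cPair (translate (fun i => if i = 0 then 0 else t) (totalChart 0 a))
                      (translate (fun i => if i = 0 then 0 else t) (totalChart 0 b)))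
      * 2 + cPair (totalChart 1 a) (totalChart 1 b) * 2 + mPair a b * (mPair a b + 1) ≤ cPair a b * 2

/-- **Lemma 2.3 (i) for an exact form at a crossing point of axes, local model.**  Over an algebraically closed
field: if (*) holds at the origin with `E` = both axes and `0 ∈ Sing(X, dF)`, then for `ω' = e^*(dF)` the sum of
`c(X', ω', ξ')` over the points `ξ'` of the exceptional curve (with `E'` = the axes through `ξ'`: the exceptional
curve, and the strict transform of the other axis at the two origins) is at most `c − m(m+1)/2`.
Named statement, not proved here. [cite: Giraud1983, Lemma 2.3 (i)] -/
def BlowupDropsStatement (K : Type*) [Field K] [IsAlgClosed K] [DecidableEq K] : Prop :=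
  ∀ F : A K, InSing Finset.univ (dOf F) →
    (∑ᶠ t : K, cLog (if t = 0 then Finset.univ else {0}) (formAtPoint 0 t (dOf F))) * 2
      + cLog Finset.univ (formAtPoint 1 0 (dOf F)) * 2
      + mLog Finset.univ (dOf F) * (mLog Finset.univ (dOf F) + 1) ≤ cLog Finset.univ (dOf F) * 2

/-! ## Condition (*) at the origin — general local reading (non-axis branches of `E(dF)` allowed)

In the atlas the zero divisor of `d f_tot` has, besides the exceptional axes, branches coming from `E(dF)`
(e.g. the line `y + z` at Hauser's antelope).  The local content of 1.2 (*) at a closed point of a smooth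
surface is: the branches of `E(d f_tot)` through the point are smooth, pairwise transversal, and at most two.
`StarAxesAt0` above is the special case in which every branch is an axis. -/

/-- a curve germ `q = 0` through the origin is SMOOTH there: the linear part of `q` is non-zero. [folklore] -/
def IsSmoothAt0 (q : A K) : Prop := homogeneousComponent 1 q ≠ 0

/-- two smooth germs through the origin are TRANSVERSAL there: their linear parts are linearly independent.
[folklore] -/
def TransversalAt0 (q q' : A K) : Prop :=
  LinearIndependent K ![homogeneousComponent 1 q, homogeneousComponent 1 q']

/-- the branches of `E(d f_tot)` through the origin in the atlas dictionary: the exceptional axes `y_i = 0`,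
`i ∈ E`, and the zero-divisor branches of `ω` (1.2: `E(f)` is the union of the `Y ∈ E` and of the reduced
components of the divisor of zeros). [cite: Giraud1983, §1.2] -/
def IsBranchAt0 (E : Finset (Fin 2)) (ω : OneForm K) (q : A K) : Prop :=
  (∃ i ∈ E, q = X i) ∨ IsZeroDivisorBranch ω q

/-- condition (*) AT THE ORIGIN, general local reading: there is a family of at most two smooth, pairwise
transversal germs through `0` representing, up to association, every branch of `E(d f_tot)` through `0`
("`E(f)` est un diviseur à croisements normaux", 1.2 (*), read at one closed point). [cite: Giraud1983, §1.2 (*)] -/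
def StarAt0 (E : Finset (Fin 2)) (ω : OneForm K) : Prop :=
  ∃ n : ℕ, n ≤ 2 ∧ ∃ b : Fin n → A K,
    (∀ k, IsBranchAt0 E ω (b k)) ∧
    (∀ q, IsBranchAt0 E ω q → ∃ k, Associated q (b k)) ∧
    (∀ k, IsSmoothAt0 (b k)) ∧
    (∀ k l, k ≠ l → TransversalAt0 (b k) (b l))

/-- (**) AT THE ORIGIN, general local reading: (*) and `c(X, ω, 0) = 0`. [cite: Giraud1983, §1.2 (**), §1.3] -/
def DoubleStarAt0 (E : Finset (Fin 2)) (ω : OneForm K) : Prop :=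
  StarAt0 E ω ∧ cLog E ω = 0

/-- THREE pairwise non-associated branches of `E(d f_tot)` through the origin — the shape of every kangaroo
source of the Resolution Observatory's `q = p` atlas (both axes exceptional and one more smooth branch of
`E(dF)`, e.g. `y`, `z`, `y + z` at Hauser's antelope `y³z³(y+z)²`, `p = 2`). [cite: Giraud1983, §1.2 (*)] -/
def ThreeBranchesAt0 (E : Finset (Fin 2)) (ω : OneForm K) : Prop :=
  ∃ q : Fin 3 → A K, (∀ i, IsBranchAt0 E ω (q i)) ∧ (∀ i j, i ≠ j → ¬ Associated (q i) (q j))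

/-- three branches through the point violate (*) (pigeonhole on the representing family). [cite: Giraud1983, §1.2 (*)] -/
theorem ThreeBranchesAt0.not_starAt0 {E : Finset (Fin 2)} {ω : OneForm K} (h : ThreeBranchesAt0 E ω) :
    ¬ StarAt0 E ω := by
  rintro ⟨n, hn, b, -, hrep, -, -⟩
  obtain ⟨q, hq, hna⟩ := h
  choose k hk using fun i => hrep (q i) (hq i)
  have hcard : Fintype.card (Fin n) < Fintype.card (Fin 3) := by simp only [Fintype.card_fin]; omega
  obtain ⟨i, j, hij, hkij⟩ := Fintype.exists_ne_map_eq_of_card_lt k hcard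
  have hj : Associated (q j) (b (k i)) := hkij ▸ hk j
  exact hna i j hij ((hk i).trans hj.symm)

/-! ## Hauser's antelope in the abstract definitions

The zero divisor of `d(y⁵z³ + y³z⁵)` in characteristic 2 has the three branches `y`, `z`, `y + z` through the
origin (kernel row `antelope_form` of the computable twin certifies `F_y = y²z³(y+z)²`, `F_z = y³z²(y+z)²` over
`𝔽₂`); here the same configuration is shown to violate (*) at the level of the `Prop`-valued definitions. -/

/-- the antelope's differential in factored shape, `(y²z³(y+z)², y³z²(y+z)²)`, as a 1-form over any field.
[cite: Giraud1983, §1.2] -/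
def antelopeForm : OneForm K := ⟨X 0 ^ 2 * X 1 ^ 3 * (X 0 + X 1) ^ 2, X 0 ^ 3 * X 1 ^ 2 * (X 0 + X 1) ^ 2⟩

/-- `y + z ≠ 0` in `K[y,z]`. [folklore] -/
theorem X_add_X_ne_zero : (X 0 + X 1 : A K) ≠ 0 := fun h => by
  have := congr_arg (eval ![(1 : K), 0]) h
  simp at this

/-- `y + z` has total degree one. [folklore] -/
theorem totalDegree_X_add_X : (X 0 + X 1 : A K).totalDegree = 1 :=
  ((isHomogeneous_X K 0).add (isHomogeneous_X K 1)).totalDegree X_add_X_ne_zero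

/-- `y + z` is irreducible in `K[y,z]`. [folklore] -/
theorem irreducible_X_add_X : Irreducible (X 0 + X 1 : A K) := by
  refine irreducible_of_totalDegree_eq_one totalDegree_X_add_X (fun x hx => ?_)
  by_cases hx0 : x = 0
  · exfalso
    apply X_add_X_ne_zero (K := K)
    ext m
    simpa [hx0] using hx m
  · exact isUnit_iff_ne_zero.mpr hx0

/-- `y + z` is a zero-divisor branch of the antelope form. [cite: Giraud1983, §1.2] -/
theorem antelopeForm_branch : IsZeroDivisorBranch (antelopeForm (K := K)) (X 0 + X 1) := by
  refine ⟨irreducible_X_add_X, by simp, ?_, ?_⟩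
  · exact Dvd.intro_left (X 0 ^ 2 * X 1 ^ 3 * (X 0 + X 1)) (by simp only [antelopeForm]; ring)
  · exact Dvd.intro_left (X 0 ^ 3 * X 1 ^ 2 * (X 0 + X 1)) (by simp only [antelopeForm]; ring)

/-- three branches `y`, `z`, `y + z` of `E(d f_tot)` through the antelope (both axes exceptional).
[cite: Giraud1983, §1.2 (*)] -/
theorem antelopeForm_threeBranches : ThreeBranchesAt0 Finset.univ (antelopeForm (K := K)) := by
  have hX : ∀ i j : Fin 2, (X i : A K) ∣ X j → i = j := fun i j h => (X_dvd_X.mp h)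
  have n01 : ¬ Associated (X 0 : A K) (X 1) := fun h => absurd (hX 0 1 h.dvd) (by decide)
  have n0s : ¬ Associated (X 0 : A K) (X 0 + X 1) := fun h => by
    have h' := dvd_sub h.dvd (dvd_refl (X 0))
    rw [add_sub_cancel_left] at h'
    exact absurd (hX 0 1 h') (by decide)
  have n1s : ¬ Associated (X 1 : A K) (X 0 + X 1) := fun h => by
    have h' := dvd_sub h.dvd (dvd_refl (X 1))
    rw [add_sub_cancel_right] at h'
    exact absurd (hX 1 0 h') (by decide)
  refine ⟨![X 0, X 1, X 0 + X 1], ?_, ?_⟩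
  · intro i
    fin_cases i
    · exact Or.inl ⟨0, Finset.mem_univ _, rfl⟩
    · exact Or.inl ⟨1, Finset.mem_univ _, rfl⟩
    · exact Or.inr antelopeForm_branch
  · intro i j hij
    fin_cases i <;> fin_cases j
    all_goals first
      | exact absurd rfl hij
      | simpa using n01
      | simpa using n01 ∘ Associated.symm
      | simpa using n0s
      | simpa using n0s ∘ Associated.symm
      | simpa using n1s
      | simpa using n1s ∘ Associated.symm

/-- hence (*) fails at the antelope. [cite: Giraud1983, §1.2 (*)] -/
theorem antelopeForm_not_starAt0 : ¬ StarAt0 Finset.univ (antelopeForm (K := K)) :=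
  antelopeForm_threeBranches.not_starAt0

/-! ## Order zero forces (*)

If `ω(0) ≠ 0` (a coefficient of `ω` is a unit at the origin) no component of the divisor of zeros passes through
the origin, so the branches of `E(d f_tot)` there are the exceptional axes alone — at most two transversal
smooth germs: (*) holds for every exceptional configuration.  (This is the degenerate case `ν(ω) = 0`; it is NOT
the mechanism at the kangaroo targets of the atlas, where `ω(0) = 0` and (**) comes from the divisorial part of
`J(X, ω, E)` — there `m = 0` refers to the finite part of 2.1–2.2.) -/

/-- no zero-divisor branch passes through a point where `ω` does not vanish. [cite: Giraud1983, §1.2 (1)] -/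
theorem IsZeroDivisorBranch.constantCoeff_eq_zero {ω : OneForm K} {q : A K} (h : IsZeroDivisorBranch ω q) :
    constantCoeff ω.a = 0 ∧ constantCoeff ω.b = 0 := by
  obtain ⟨-, hq0, hqa, hqb⟩ := h
  have ha := map_dvd constantCoeff hqa
  have hb := map_dvd constantCoeff hqb
  rw [hq0, zero_dvd_iff] at ha hb
  exact ⟨ha, hb⟩

/-- (*) from an injective enumeration of the exceptional axes when `ω(0) ≠ 0`. [cite: Giraud1983, §1.2 (*)] -/
theorem starAt0_of_axes_enum (E : Finset (Fin 2)) {ω : OneForm K}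
    (hω : constantCoeff ω.a ≠ 0 ∨ constantCoeff ω.b ≠ 0) {n : ℕ} (hn : n ≤ 2) (e : Fin n → Fin 2)
    (he : Function.Injective e) (hE : ∀ i, i ∈ E ↔ ∃ k, e k = i) : StarAt0 E ω := by
  have hX1 : ∀ i : Fin 2, homogeneousComponent 1 (X i : A K) = X i :=
    fun i => homogeneousComponent_eq_self (isHomogeneous_X K i)
  have noZD : ∀ q, ¬ IsZeroDivisorBranch ω q := fun q hq => by
    obtain ⟨ha, hb⟩ := hq.constantCoeff_eq_zero
    exact hω.elim (fun h => h ha) (fun h => h hb)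
  refine ⟨n, hn, fun k => X (e k), ?_, ?_, ?_, ?_⟩
  · exact fun k => Or.inl ⟨e k, (hE _).mpr ⟨k, rfl⟩, rfl⟩
  · rintro q (⟨i, hi, rfl⟩ | hq)
    · obtain ⟨k, hk⟩ := (hE i).mp hi
      exact ⟨k, by subst hk; exact Associated.refl _⟩
    · exact absurd hq (noZD q)
  · intro k
    show homogeneousComponent 1 (X (e k) : A K) ≠ 0
    rw [hX1]
    exact X_ne_zero _
  · intro k l hkl
    show LinearIndependent K ![homogeneousComponent 1 (X (e k) : A K), homogeneousComponent 1 (X (e l))]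
    rw [hX1, hX1]
    have hfun : (![X (e k), X (e l)] : Fin 2 → A K) = (X : Fin 2 → A K) ∘ ![e k, e l] := by
      ext i : 1
      fin_cases i <;> rfl
    rw [hfun]
    refine (linearIndependent_X (Fin 2) K).comp _ ?_
    have hne : e k ≠ e l := fun h => hkl (he h)
    intro i j hij
    fin_cases i <;> fin_cases j
    · rfl
    · exact absurd hij hne
    · exact absurd hij.symm hne
    · rfl

/-- ORDER ZERO FORCES (*): if a coefficient of `ω` does not vanish at the origin then (*) holds there, whatever the
exceptional axes (the degenerate case `ν(ω) = 0` of 1.2). [cite: Giraud1983, §1.2 (*)] -/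
theorem starAt0_of_constantCoeff_ne_zero (E : Finset (Fin 2)) {ω : OneForm K}
    (hω : constantCoeff ω.a ≠ 0 ∨ constantCoeff ω.b ≠ 0) : StarAt0 E ω := by
  by_cases h0 : (0 : Fin 2) ∈ E <;> by_cases h1 : (1 : Fin 2) ∈ E
  · refine starAt0_of_axes_enum E hω le_rfl ![0, 1] (by decide) (fun i => ?_)
    fin_cases i <;> simp [h0, h1, Fin.exists_fin_two]
  · refine starAt0_of_axes_enum E hω (by norm_num) ![0] (Function.injective_of_subsingleton _) (fun i => ?_)
    fin_cases i <;> simp [h0, h1]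
  · refine starAt0_of_axes_enum E hω (by norm_num) ![1] (Function.injective_of_subsingleton _) (fun i => ?_)
    fin_cases i <;> simp [h0, h1]
  · refine starAt0_of_axes_enum E hω (Nat.zero_le 2) ![] (Function.injective_of_subsingleton _) (fun i => ?_)
    fin_cases i <;> simp [h0, h1]

/-! ## The kangaroo target in the abstract definitions

At the kangaroo point of Hauser's example, after cleaning, the state is `y⁶(z³ + z⁵)` with the new exceptional axis
`y = 0` (`p = 2`).  Its differential in characteristic 2 is `(0, y⁶z²(1+z)²)`; the logarithmic ideal
`J = (y·0, y⁶z²(1+z)²)` is principal, so its finite part is trivial: `c = 0`, and the branches of `E(d f_tot)` through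
the point are the two axes — (**) holds, Giraud's invariant is terminal, while Hauser's shade has just risen
(kernel row `kangaroo_form`).  The general facts: a principal pair has colength zero; (*) from two axis branches. -/

/-- a common multiple of the pair divides the chosen gcd. [folklore] -/
theorem dvd_gcdPair {d a b : A K} (h₁ : d ∣ a) (h₂ : d ∣ b) : d ∣ gcdPair a b := by
  classical
  letI : GCDMonoid (A K) := UniqueFactorizationMonoid.toGCDMonoid (A K)
  exact dvd_gcd h₁ h₂

/-- the colength of the unit ideal is zero. [folklore] -/
theorem colengthAtOrigin_top : colengthAtOrigin (⊤ : Ideal (A K)) = 0 := by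
  unfold colengthAtOrigin
  simp

/-- `D(I) = (1)` for the principal pair `I = (0, b)`, `b ≠ 0`: the second cofactor of the gcd is a unit.
[cite: Giraud1983, §2.1 (2)] -/
theorem finitePart_eq_top_of_left_eq_zero {b : A K} (hb : b ≠ 0) : finitePart 0 b = ⊤ := by
  have hmul := gcdPair_mul_finitePartGens_snd (0 : A K) b
  obtain ⟨e, he⟩ := dvd_gcdPair (dvd_zero b) (dvd_refl b)
  have hunit : IsUnit (finitePartGens (0 : A K) b).2 := by
    refine isUnit_iff_exists_inv.mpr ⟨e, ?_⟩
    have h1 : b * ((finitePartGens (0 : A K) b).2 * e) = b * 1 := by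
      rw [mul_one]
      conv_rhs => rw [← hmul, he]
      ring
    exact mul_left_cancel₀ hb h1
  exact Ideal.eq_top_of_isUnit_mem _ (Ideal.subset_span (by simp)) hunit

/-- `D(I) = (1)` for the principal pair `I = (a, 0)`, `a ≠ 0`. [cite: Giraud1983, §2.1 (2)] -/
theorem finitePart_eq_top_of_right_eq_zero {a : A K} (ha : a ≠ 0) : finitePart a 0 = ⊤ := by
  have hmul := gcdPair_mul_finitePartGens_fst a (0 : A K)
  obtain ⟨e, he⟩ := dvd_gcdPair (dvd_refl a) (dvd_zero a)
  have hunit : IsUnit (finitePartGens a (0 : A K)).1 := by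
    refine isUnit_iff_exists_inv.mpr ⟨e, ?_⟩
    have h1 : a * ((finitePartGens a (0 : A K)).1 * e) = a * 1 := by
      rw [mul_one]
      conv_rhs => rw [← hmul, he]
      ring
    exact mul_left_cancel₀ ha h1
  exact Ideal.eq_top_of_isUnit_mem _ (Ideal.subset_span (by simp)) hunit

/-- a principal pair `(0, b)`, `b ≠ 0`, has `c = 0`. [cite: Giraud1983, §2.1 (3)] -/
theorem cPair_eq_zero_of_left_eq_zero {b : A K} (hb : b ≠ 0) : cPair 0 b = 0 := by
  unfold cPair
  rw [finitePart_eq_top_of_left_eq_zero hb]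
  exact colengthAtOrigin_top

/-- a principal pair `(a, 0)`, `a ≠ 0`, has `c = 0`. [cite: Giraud1983, §2.1 (3)] -/
theorem cPair_eq_zero_of_right_eq_zero {a : A K} (ha : a ≠ 0) : cPair a 0 = 0 := by
  unfold cPair
  rw [finitePart_eq_top_of_right_eq_zero ha]
  exact colengthAtOrigin_top

/-- `y_i` is irreducible. [folklore] -/
theorem irreducible_X (i : Fin 2) : Irreducible (X i : A K) :=
  irreducible_of_totalDegree_eq_one ((isHomogeneous_X K i).totalDegree (X_ne_zero i)) (fun x hx => by
    by_cases hx0 : x = 0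
    · exfalso
      apply X_ne_zero (R := K) (σ := Fin 2) i
      ext m
      simpa [hx0] using hx m
    · exact isUnit_iff_ne_zero.mpr hx0)

/-- (*) from the two axes: if both axes are branches of `E(d f_tot)` at the point and every branch is associated to
one of them, (*) holds with the representing family `(y, z)`. [cite: Giraud1983, §1.2 (*)] -/
theorem starAt0_of_two_axes (E : Finset (Fin 2)) {ω : OneForm K} (h0 : IsBranchAt0 E ω (X 0))
    (h1 : IsBranchAt0 E ω (X 1)) (hrep : ∀ q, IsBranchAt0 E ω q → Associated q (X 0) ∨ Associated q (X 1)) :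
    StarAt0 E ω := by
  have hX1 : ∀ i : Fin 2, homogeneousComponent 1 (X i : A K) = X i :=
    fun i => homogeneousComponent_eq_self (isHomogeneous_X K i)
  refine ⟨2, le_rfl, ![X 0, X 1], ?_, ?_, ?_, ?_⟩
  · intro k
    fin_cases k
    · exact h0
    · exact h1
  · intro q hq
    rcases hrep q hq with h | h
    · exact ⟨0, h⟩
    · exact ⟨1, h⟩
  · intro k
    fin_cases k
    · show homogeneousComponent 1 (X 0 : A K) ≠ 0
      rw [hX1]; exact X_ne_zero _
    · show homogeneousComponent 1 (X 1 : A K) ≠ 0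
      rw [hX1]; exact X_ne_zero _
  · have hfun : ∀ a b : Fin 2, (![X a, X b] : Fin 2 → A K) = (X : Fin 2 → A K) ∘ ![a, b] := fun a b => by
      ext i : 1
      fin_cases i <;> rfl
    intro k l hkl
    fin_cases k <;> fin_cases l
    · exact absurd rfl hkl
    · show LinearIndependent K ![homogeneousComponent 1 (X 0 : A K), homogeneousComponent 1 (X 1)]
      rw [hX1, hX1, hfun]
      exact (linearIndependent_X (Fin 2) K).comp _ (by decide)
    · show LinearIndependent K ![homogeneousComponent 1 (X 1 : A K), homogeneousComponent 1 (X 0)]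
      rw [hX1, hX1, hfun]
      exact (linearIndependent_X (Fin 2) K).comp _ (by decide)
    · exact absurd rfl hkl

/-- the kangaroo target's differential in factored shape, `(0, y⁶z²(1+z)²)`, over any field. [folklore] -/
def kangarooForm : OneForm K := ⟨0, X 0 ^ 6 * X 1 ^ 2 * (1 + X 1) ^ 2⟩

/-- `1 + z ≠ 0`. [folklore] -/
theorem one_add_X_ne_zero : (1 + X 1 : A K) ≠ 0 := fun h => by
  have := congr_arg (eval ![(0 : K), 0]) h
  simp at this

/-- the second coefficient of the kangaroo form is non-zero. [folklore] -/
theorem kangarooForm_b_ne_zero : (kangarooForm (K := K)).b ≠ 0 :=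
  mul_ne_zero (mul_ne_zero (pow_ne_zero _ (X_ne_zero _)) (pow_ne_zero _ (X_ne_zero _)))
    (pow_ne_zero _ one_add_X_ne_zero)

/-- a zero-divisor branch of the kangaroo form is one of the axes. [folklore] -/
theorem kangarooForm_branch_axes {q : A K} (hq : IsZeroDivisorBranch (kangarooForm (K := K)) q) :
    Associated q (X 0) ∨ Associated q (X 1) := by
  obtain ⟨hirr, hq0, -, hqb⟩ := hq
  have hprime : Prime q := UniqueFactorizationMonoid.irreducible_iff_prime.mp hirr
  change q ∣ X 0 ^ 6 * X 1 ^ 2 * (1 + X 1) ^ 2 at hqb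
  rcases hprime.dvd_or_dvd hqb with h | h
  · rcases hprime.dvd_or_dvd h with h' | h'
    · exact Or.inl (hirr.associated_of_dvd (irreducible_X 0) (hprime.dvd_of_dvd_pow h'))
    · exact Or.inr (hirr.associated_of_dvd (irreducible_X 1) (hprime.dvd_of_dvd_pow h'))
  · exfalso
    have h1 := map_dvd constantCoeff (hprime.dvd_of_dvd_pow h)
    rw [hq0, zero_dvd_iff] at h1
    simp at h1

/-- (**) AT THE KANGAROO TARGET (abstract form, any field): with the new exceptional axis `y = 0`, the branches of
`E(d f_tot)` at the point are the two axes (`z` is a component of `E(ω)`), and `c = 0` because `J(X, ω, E) =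
(y·0, ω_b)` is principal. [cite: Giraud1983, §1.2 (**), §2.2] -/
theorem kangarooForm_doubleStarAt0 : DoubleStarAt0 {0} (kangarooForm (K := K)) := by
  have hzb : IsZeroDivisorBranch (kangarooForm (K := K)) (X 1) :=
    ⟨irreducible_X 1, constantCoeff_X K 1, dvd_zero _,
      Dvd.intro_left (X 0 ^ 6 * X 1 * (1 + X 1) ^ 2) (by simp only [kangarooForm]; ring)⟩
  refine ⟨starAt0_of_two_axes {0} (Or.inl ⟨0, Finset.mem_singleton_self 0, rfl⟩) (Or.inr hzb) ?_, ?_⟩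
  · rintro q (⟨i, hi, rfl⟩ | hq)
    · rw [Finset.mem_singleton] at hi
      subst hi
      exact Or.inl (Associated.refl _)
    · exact kangarooForm_branch_axes hq
  · show cPair ((if (0 : Fin 2) ∈ ({0} : Finset (Fin 2)) then X 0 else 1) * (kangarooForm (K := K)).a)
        ((if (1 : Fin 2) ∈ ({0} : Finset (Fin 2)) then X 1 else 1) * (kangarooForm (K := K)).b) = 0
    have ha : (kangarooForm (K := K)).a = 0 := rfl
    rw [ha, mul_zero, if_neg (by decide), one_mul]
    exact cPair_eq_zero_of_left_eq_zero kangarooForm_b_ne_zero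

/-! ## Soundness of the `c = 0` certificate

The kernel rows certify `(m, c) = (0, 0)` by exhibiting a factorisation of the logarithmic generators
`(a, b) = h·(u₁, u₂)` with a unit-at-the-origin cofactor.  At `Prop` level this forces `c(J) = 0` for the TRUE
finite part (whatever gcd and cofactors the definitions chose): the chosen first cofactor divides `u₁`, hence does
not vanish at the origin, and an ideal containing an element with non-zero constant term is comaximal with every
power of the maximal ideal of the origin. -/

/-- a polynomial vanishing at the origin lies in the ideal `(y, z)` of the origin. [folklore] -/
theorem mem_origin_of_constantCoeff_eq_zero {q : A K} (hq : constantCoeff q = 0) : q ∈ origin K := by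
  have hset : ({X 0, X 1} : Set (A K)) = MvPolynomial.X '' Set.univ := by
    ext f
    simp only [Set.mem_insert_iff, Set.mem_singleton_iff, Set.image_univ, Set.mem_range]
    constructor
    · rintro (rfl | rfl)
      · exact ⟨0, rfl⟩
      · exact ⟨1, rfl⟩
    · rintro ⟨i, rfl⟩
      fin_cases i
      · exact Or.inl rfl
      · exact Or.inr rfl
  unfold origin
  rw [hset, mem_ideal_span_X_image]
  intro m hm
  have hm0 : m ≠ 0 := by
    rintro rfl
    rw [MvPolynomial.mem_support_iff] at hm
    exact hm hq
  by_contra hall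
  refine hm0 (Finsupp.ext fun i => ?_)
  by_contra hi
  exact hall ⟨i, Set.mem_univ i, hi⟩

/-- an ideal containing an element with non-zero constant term is comaximal with every power of the ideal of the
origin (geometric series). [folklore] -/
theorem sup_origin_pow_eq_top {I : Ideal (A K)} {q : A K} (hqI : q ∈ I) (hq : constantCoeff q ≠ 0) (N : ℕ) :
    I ⊔ origin K ^ (N + 1) = ⊤ := by
  set c : K := constantCoeff q with hc
  set m₁ : A K := q - C c with hm₁
  have hm₁0 : m₁ ∈ origin K := mem_origin_of_constantCoeff_eq_zero (by simp [hm₁, hc])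
  set y : A K := -C c⁻¹ * m₁ with hy
  have hyO : y ∈ origin K := Ideal.mul_mem_left _ _ hm₁0
  have hcc : C c * C c⁻¹ = (1 : A K) := by rw [← C_mul, mul_inv_cancel₀ hq, C_1]
  have hqdec : q = C c * (1 - y) := by
    have : q = C c + m₁ := by rw [hm₁]; ring
    calc q = C c + m₁ := this
      _ = C c + (C c * C c⁻¹) * m₁ := by rw [hcc, one_mul]
      _ = C c * (1 - y) := by rw [hy]; ring
  set S : A K := ∑ i ∈ Finset.range (N + 1), y ^ i with hS
  have hgeom : (1 - y) * S = 1 - y ^ (N + 1) := mul_neg_geom_sum y (N + 1)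
  have h1 : (1 : A K) = q * (C c⁻¹ * S) + y ^ (N + 1) := by
    have : q * (C c⁻¹ * S) = (1 - y) * S := by
      rw [hqdec]
      calc C c * (1 - y) * (C c⁻¹ * S) = (C c * C c⁻¹) * ((1 - y) * S) := by ring
        _ = (1 - y) * S := by rw [hcc, one_mul]
    rw [this, hgeom]
    ring
  rw [Ideal.eq_top_iff_one, h1]
  exact Submodule.add_mem_sup (Ideal.mul_mem_right _ _ hqI) (Ideal.pow_mem_pow hyO (N + 1))

/-- an ideal containing an element with non-zero constant term has colength zero at the origin. [folklore] -/
theorem colengthAtOrigin_eq_zero_of_mem {I : Ideal (A K)} {q : A K} (hqI : q ∈ I) (hq : constantCoeff q ≠ 0) :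
    colengthAtOrigin I = 0 := by
  unfold colengthAtOrigin
  have h : ∀ N : ℕ, Module.length (A K) ((A K) ⧸ (I ⊔ origin K ^ (N + 1))) = 0 := fun N => by
    rw [sup_origin_pow_eq_top hqI hq N]
    exact Module.length_eq_zero_iff.mpr (Ideal.Quotient.subsingleton_iff.mpr rfl)
  simp [h]

/-- under a certificate `(a, b) = h·(u₁, u₂)`, `h ≠ 0`, `u₁(0) ≠ 0`, the chosen first cofactor of the true gcd does not
vanish at the origin (it divides `u₁`). [cite: Giraud1983, §2.1 (2)] -/
theorem constantCoeff_finitePartGens_fst_ne_zero {a b h u₁ u₂ : A K} (hh : h ≠ 0) (ha : a = h * u₁)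
    (hb : b = h * u₂) (hu : constantCoeff u₁ ≠ 0) : constantCoeff (finitePartGens a b).1 ≠ 0 := by
  obtain ⟨g', hg'⟩ := dvd_gcdPair (a := a) (b := b) ⟨u₁, ha⟩ ⟨u₂, hb⟩
  have hmul := gcdPair_mul_finitePartGens_fst a b
  have hdvd : (finitePartGens a b).1 ∣ u₁ := by
    refine ⟨g', ?_⟩
    have h1 : h * (g' * (finitePartGens a b).1) = h * u₁ :=
      calc h * (g' * (finitePartGens a b).1) = gcdPair a b * (finitePartGens a b).1 := by rw [hg']; ring
        _ = a := hmul
        _ = h * u₁ := ha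
    have := mul_left_cancel₀ hh h1
    rw [← this]
    ring
  intro h0
  have := map_dvd constantCoeff hdvd
  rw [h0, zero_dvd_iff] at this
  exact hu this

/-- the same for the second cofactor. [cite: Giraud1983, §2.1 (2)] -/
theorem constantCoeff_finitePartGens_snd_ne_zero {a b h u₁ u₂ : A K} (hh : h ≠ 0) (ha : a = h * u₁)
    (hb : b = h * u₂) (hu : constantCoeff u₂ ≠ 0) : constantCoeff (finitePartGens a b).2 ≠ 0 := by
  obtain ⟨g', hg'⟩ := dvd_gcdPair (a := a) (b := b) ⟨u₁, ha⟩ ⟨u₂, hb⟩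
  have hmul := gcdPair_mul_finitePartGens_snd a b
  have hdvd : (finitePartGens a b).2 ∣ u₂ := by
    refine ⟨g', ?_⟩
    have h1 : h * (g' * (finitePartGens a b).2) = h * u₂ :=
      calc h * (g' * (finitePartGens a b).2) = gcdPair a b * (finitePartGens a b).2 := by rw [hg']; ring
        _ = b := hmul
        _ = h * u₂ := hb
    have := mul_left_cancel₀ hh h1
    rw [← this]
    ring
  intro h0
  have := map_dvd constantCoeff hdvd
  rw [h0, zero_dvd_iff] at this
  exact hu this

/-- SOUNDNESS OF THE `c = 0` CERTIFICATE: if `(a, b) = h·(u₁, u₂)` with `h ≠ 0` and a cofactor not vanishing at the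
origin then the true finite part `D(I)` of `I = (a, b)` has `c(I) = long 𝒪/D(I) = 0`. [cite: Giraud1983, §2.1 (2)–(3)] -/
theorem cPair_eq_zero_of_certificate {a b h u₁ u₂ : A K} (hh : h ≠ 0) (ha : a = h * u₁) (hb : b = h * u₂)
    (hu : constantCoeff u₁ ≠ 0 ∨ constantCoeff u₂ ≠ 0) : cPair a b = 0 := by
  rcases hu with hu | hu
  · exact colengthAtOrigin_eq_zero_of_mem (Ideal.subset_span (by simp))
      (constantCoeff_finitePartGens_fst_ne_zero hh ha hb hu)
  · exact colengthAtOrigin_eq_zero_of_mem (Ideal.subset_span (by simp))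
      (constantCoeff_finitePartGens_snd_ne_zero hh ha hb hu)

/-- a polynomial with non-zero constant term has order `0` at the origin. [folklore] -/
theorem ordZero_eq_zero_of_constantCoeff_ne_zero {P : A K} (h : constantCoeff P ≠ 0) : ordZero P = 0 := by
  rw [show (0 : ℕ∞) = ((0 : ℕ) : ℕ∞) from rfl, Hauser2010.ordZero_eq_nat_iff]
  exact ⟨⟨0, h, by simp⟩, fun d hd => absurd hd (Nat.not_lt_zero _)⟩

/-- SOUNDNESS OF THE `m = 0` CERTIFICATE: under the same certificate the true finite part has `m = ν(D(I)) = 0`.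
[cite: Giraud1983, §2.1 (3)] -/
theorem mPair_eq_zero_of_certificate {a b h u₁ u₂ : A K} (hh : h ≠ 0) (ha : a = h * u₁) (hb : b = h * u₂)
    (hu : constantCoeff u₁ ≠ 0 ∨ constantCoeff u₂ ≠ 0) : mPair a b = 0 := by
  unfold mPair
  rcases hu with hu | hu
  · rw [ordZero_eq_zero_of_constantCoeff_ne_zero (constantCoeff_finitePartGens_fst_ne_zero hh ha hb hu)]
    exact min_eq_left bot_le
  · rw [ordZero_eq_zero_of_constantCoeff_ne_zero (constantCoeff_finitePartGens_snd_ne_zero hh ha hb hu)]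
    exact min_eq_right bot_le

/-- SOUNDNESS OF THE `(m, c) = (0, 0)` CERTIFICATE for the logarithmic ideal of 2.2: a factorisation of the log
generators `(y_E·ω_a, z_E·ω_b) = h·(u₁, u₂)`, `h ≠ 0`, with a cofactor not vanishing at the origin, gives
`(m, c) = (0, 0)` for the TRUE finite part — the `Prop` reading of `certLog … = some (0, 0)` in the kernel rows, for
whatever gcd / cofactors the noncomputable definitions chose. [cite: Giraud1983, §2.1–2.2] -/
theorem mLog_cLog_eq_zero_of_certificate (E : Finset (Fin 2)) (ω : OneForm K) {h u₁ u₂ : A K} (hh : h ≠ 0)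
    (h₁ : (logJacobianGens E ω).1 = h * u₁) (h₂ : (logJacobianGens E ω).2 = h * u₂)
    (hu : constantCoeff u₁ ≠ 0 ∨ constantCoeff u₂ ≠ 0) : mLog E ω = 0 ∧ cLog E ω = 0 :=
  ⟨mPair_eq_zero_of_certificate hh h₁ h₂ hu, cPair_eq_zero_of_certificate hh h₁ h₂ hu⟩

/-- (**) FROM (*) AND A CERTIFICATE. [cite: Giraud1983, §1.2 (**), §2.2] -/
theorem doubleStarAt0_of_certificate (E : Finset (Fin 2)) (ω : OneForm K) (hstar : StarAt0 E ω) {h u₁ u₂ : A K}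
    (hh : h ≠ 0) (h₁ : (logJacobianGens E ω).1 = h * u₁) (h₂ : (logJacobianGens E ω).2 = h * u₂)
    (hu : constantCoeff u₁ ≠ 0 ∨ constantCoeff u₂ ≠ 0) : DoubleStarAt0 E ω :=
  ⟨hstar, (mLog_cLog_eq_zero_of_certificate E ω hh h₁ h₂ hu).2⟩

/-- the kangaroo form carries the certificate `(y·0, ω_b) = ω_b·(0, 1)`: `(m, c) = (0, 0)` for its true finite part.
[cite: Giraud1983, §2.2] -/
theorem kangarooForm_mLog_cLog : mLog {0} (kangarooForm (K := K)) = 0 ∧ cLog {0} (kangarooForm (K := K)) = 0 := by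
  refine mLog_cLog_eq_zero_of_certificate {0} kangarooForm (h := (kangarooForm (K := K)).b) (u₁ := 0) (u₂ := 1)
    kangarooForm_b_ne_zero ?_ ?_ (Or.inr (by simp))
  · show (if (0 : Fin 2) ∈ ({0} : Finset (Fin 2)) then X 0 else 1) * (kangarooForm (K := K)).a = _
    have ha : (kangarooForm (K := K)).a = 0 := rfl
    rw [ha, mul_zero, mul_zero]
  · show (if (1 : Fin 2) ∈ ({0} : Finset (Fin 2)) then X 1 else 1) * (kangarooForm (K := K)).b = _
    rw [if_neg (by decide), one_mul, mul_one]

/-- the kangaroo form's REDUCED invariant is terminal too: `(μ, χ) = (0, 0)` (the pair `(0, ω_b) = ω_b·(0, 1)` is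
principal). [cite: Giraud1983, §2.1, Rem. 2.7] -/
theorem kangarooForm_mu_chi : mu (kangarooForm (K := K)) = 0 ∧ chi (kangarooForm (K := K)) = 0 := by
  have ha : (kangarooForm (K := K)).a = (kangarooForm (K := K)).b * 0 := by rw [mul_zero]; rfl
  have hb : (kangarooForm (K := K)).b = (kangarooForm (K := K)).b * 1 := (mul_one _).symm
  exact ⟨mPair_eq_zero_of_certificate kangarooForm_b_ne_zero ha hb (Or.inr (by simp)),
    cPair_eq_zero_of_certificate kangarooForm_b_ne_zero ha hb (Or.inr (by simp))⟩

/-- SOUNDNESS OF THE `(0, 0)` REDUCED CERTIFICATE: `ω = h·(u₁, u₂)`, `h ≠ 0`, a cofactor non-zero at the origin ⇒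
`(μ, χ) = (0, 0)` for the TRUE reduced finite part. [cite: Giraud1983, §2.1, Rem. 2.7] -/
theorem mu_chi_eq_zero_of_certificate (ω : OneForm K) {h u₁ u₂ : A K} (hh : h ≠ 0) (ha : ω.a = h * u₁)
    (hb : ω.b = h * u₂) (hu : constantCoeff u₁ ≠ 0 ∨ constantCoeff u₂ ≠ 0) : mu ω = 0 ∧ chi ω = 0 :=
  ⟨mPair_eq_zero_of_certificate hh ha hb hu, cPair_eq_zero_of_certificate hh ha hb hu⟩

/-! ## Exact forms supported on the axes: the shape of every atlas kangaroo target

With the new exceptional axis `y` and `ω = (0, yⁱ zʲ u)`, `j ≥ 1`, `u(0) ≠ 0` (the shape `dF' = (0, F'_z)` of the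
targets in the cell's census, `F'_y` being killed by `p ∣ r_y`), the branches of `E(d f_tot)` at the point are the two
axes, `J(X, ω, E) = (0, ω_b)` and `(ω_a, ω_b) = ω_b·(0, 1)` are principal: (**) holds with `(m, c) = (0, 0)` and
`(μ, χ) = (0, 0)`.  `kangarooForm = axisForm 6 2 ((1 + z)²)`. -/

/-- the exact 1-form `(0, yⁱ zʲ u)`. [cite: Giraud1983, §1.2, §2.2] -/
def axisForm (i j : ℕ) (u : A K) : OneForm K := ⟨0, X 0 ^ i * X 1 ^ j * u⟩

/-- Hauser's kangaroo form is `axisForm 6 2 ((1 + z)²)`. [folklore] -/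
theorem kangarooForm_eq_axisForm : kangarooForm (K := K) = axisForm 6 2 ((1 + X 1) ^ 2) := rfl

/-- its `dz`-coefficient is non-zero when `u(0) ≠ 0`. [folklore] -/
theorem axisForm_b_ne_zero (i j : ℕ) {u : A K} (hu : constantCoeff u ≠ 0) : (axisForm i j u).b ≠ 0 := by
  have hu0 : u ≠ 0 := fun h => hu (by rw [h, map_zero])
  exact mul_ne_zero (mul_ne_zero (pow_ne_zero _ (X_ne_zero _)) (pow_ne_zero _ (X_ne_zero _))) hu0

/-- a zero-divisor branch of `axisForm i j u`, `u(0) ≠ 0`, is one of the axes. [folklore] -/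
theorem axisForm_branch_axes (i j : ℕ) {u : A K} (hu : constantCoeff u ≠ 0) {q : A K}
    (hq : IsZeroDivisorBranch (axisForm i j u) q) : Associated q (X 0) ∨ Associated q (X 1) := by
  obtain ⟨hirr, hq0, -, hqb⟩ := hq
  have hprime : Prime q := UniqueFactorizationMonoid.irreducible_iff_prime.mp hirr
  change q ∣ X 0 ^ i * X 1 ^ j * u at hqb
  rcases hprime.dvd_or_dvd hqb with h | h
  · rcases hprime.dvd_or_dvd h with h' | h'
    · exact Or.inl (hirr.associated_of_dvd (irreducible_X 0) (hprime.dvd_of_dvd_pow h'))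
    · exact Or.inr (hirr.associated_of_dvd (irreducible_X 1) (hprime.dvd_of_dvd_pow h'))
  · exfalso
    have h1 := map_dvd constantCoeff h
    rw [hq0, zero_dvd_iff] at h1
    exact hu h1

/-- (**) at `axisForm i j u` (`j ≥ 1`, `u(0) ≠ 0`) with the axis `y` exceptional. [cite: Giraud1983, §1.2 (**), §2.2] -/
theorem axisForm_doubleStarAt0 (i : ℕ) {j : ℕ} (hj : 1 ≤ j) {u : A K} (hu : constantCoeff u ≠ 0) :
    DoubleStarAt0 {0} (axisForm i j u) := by
  have hzb : IsZeroDivisorBranch (axisForm i j u) (X 1) := by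
    refine ⟨irreducible_X 1, constantCoeff_X K 1, dvd_zero _, ?_⟩
    obtain ⟨k, hk⟩ := Nat.exists_eq_add_of_le hj
    exact ⟨X 0 ^ i * X 1 ^ k * u, by simp only [axisForm, hk, pow_add, pow_one]; ring⟩
  refine ⟨starAt0_of_two_axes {0} (Or.inl ⟨0, Finset.mem_singleton_self 0, rfl⟩) (Or.inr hzb) ?_, ?_⟩
  · rintro q (⟨i, hi, rfl⟩ | hq)
    · rw [Finset.mem_singleton] at hi
      subst hi
      exact Or.inl (Associated.refl _)
    · exact axisForm_branch_axes i j hu hq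
  · show cPair ((if (0 : Fin 2) ∈ ({0} : Finset (Fin 2)) then X 0 else 1) * (axisForm i j u).a)
        ((if (1 : Fin 2) ∈ ({0} : Finset (Fin 2)) then X 1 else 1) * (axisForm i j u).b) = 0
    have ha : (axisForm i j u).a = 0 := rfl
    rw [ha, mul_zero, if_neg (by decide), one_mul]
    exact cPair_eq_zero_of_left_eq_zero (axisForm_b_ne_zero i j hu)

/-- `(m, c) = (0, 0)` at `axisForm i j u` (`u(0) ≠ 0`), axis `y` exceptional: certificate `(y·0, ω_b) = ω_b·(0, 1)`.
[cite: Giraud1983, §2.2] -/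
theorem axisForm_mLog_cLog (i j : ℕ) {u : A K} (hu : constantCoeff u ≠ 0) :
    mLog {0} (axisForm i j u) = 0 ∧ cLog {0} (axisForm i j u) = 0 := by
  refine mLog_cLog_eq_zero_of_certificate {0} (axisForm i j u) (h := (axisForm i j u).b) (u₁ := 0) (u₂ := 1)
    (axisForm_b_ne_zero i j hu) ?_ ?_ (Or.inr (by simp))
  · show (if (0 : Fin 2) ∈ ({0} : Finset (Fin 2)) then X 0 else 1) * (axisForm i j u).a = _
    have ha : (axisForm i j u).a = 0 := rfl
    rw [ha, mul_zero, mul_zero]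
  · show (if (1 : Fin 2) ∈ ({0} : Finset (Fin 2)) then X 1 else 1) * (axisForm i j u).b = _
    rw [if_neg (by decide), one_mul, mul_one]

/-- `(μ, χ) = (0, 0)` at `axisForm i j u` (`u(0) ≠ 0`): certificate `(0, ω_b) = ω_b·(0, 1)`. [cite: Giraud1983, §2.1, Rem. 2.7] -/
theorem axisForm_mu_chi (i j : ℕ) {u : A K} (hu : constantCoeff u ≠ 0) :
    mu (axisForm i j u) = 0 ∧ chi (axisForm i j u) = 0 := by
  have ha : (axisForm i j u).a = (axisForm i j u).b * 0 := by rw [mul_zero]; rfl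
  have hb : (axisForm i j u).b = (axisForm i j u).b * 1 := (mul_one _).symm
  exact ⟨mPair_eq_zero_of_certificate (axisForm_b_ne_zero i j hu) ha hb (Or.inr (by simp)),
    cPair_eq_zero_of_certificate (axisForm_b_ne_zero i j hu) ha hb (Or.inr (by simp))⟩

/-- THE TARGET READING, assembled: at `axisForm i j u` (`j ≥ 1`, `u(0) ≠ 0`) with the axis `y` exceptional,
(**) holds, `(m, c) = (0, 0)` and `(μ, χ) = (0, 0)` — Giraud's invariants are terminal. [cite: Giraud1983, §1.2 (**), §2.1, §2.2, Rem. 2.7] -/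
theorem axisForm_giraudReading (i : ℕ) {j : ℕ} (hj : 1 ≤ j) {u : A K} (hu : constantCoeff u ≠ 0) :
    DoubleStarAt0 {0} (axisForm i j u) ∧ mLog {0} (axisForm i j u) = 0 ∧ cLog {0} (axisForm i j u) = 0 ∧
      mu (axisForm i j u) = 0 ∧ chi (axisForm i j u) = 0 :=
  ⟨axisForm_doubleStarAt0 i hj hu, (axisForm_mLog_cLog i j hu).1, (axisForm_mLog_cLog i j hu).2, axisForm_mu_chi i j hu⟩

/-! ## The antelope source: reduced invariant already terminal, `(μ, χ) = (1, 1)`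

For `ω = y²z²(y+z)²·(z dy + y dz)` (the antelope form) the reduced finite part is `D(dF) = (z, y) = 𝔪` itself —
whatever gcd and cofactors were chosen — so `μ = ν(𝔪) = 1` and `χ = long 𝒪/𝔪 = 1`: the REDUCED invariant of
Rem. 2.7 is terminal at the kangaroo SOURCE as well (kernel row `antelope_form`: `certRed … = some (1, 1)`).  It
cannot see the kangaroo; only (*) does. -/

/-- members of the ideal of the origin vanish at the origin. [folklore] -/
theorem constantCoeff_eq_zero_of_mem_origin {q : A K} (hq : q ∈ origin K) : constantCoeff q = 0 := by
  have hle : origin K ≤ RingHom.ker (constantCoeff : A K →+* K) := by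
    unfold origin
    rw [Ideal.span_le]
    intro f hf
    simp only [Set.mem_insert_iff, Set.mem_singleton_iff] at hf
    rcases hf with rfl | rfl <;> simp [RingHom.mem_ker]
  exact hle hq

/-- the ideal `(y, z)` of the origin is maximal. [folklore] -/
theorem origin_isMaximal : (origin K).IsMaximal := by
  rw [Ideal.isMaximal_iff]
  refine ⟨fun h1 => ?_, fun J x hOJ hxO hxJ => ?_⟩
  · have := constantCoeff_eq_zero_of_mem_origin h1
    simp at this
  · have hx : constantCoeff x ≠ 0 := fun h0 => hxO (mem_origin_of_constantCoeff_eq_zero h0)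
    have htop := sup_origin_pow_eq_top (I := J) hxJ hx 0
    rw [zero_add, pow_one] at htop
    have hJ : J = ⊤ := top_le_iff.mp (htop ▸ sup_le le_rfl hOJ)
    rw [hJ]
    exact Submodule.mem_top

/-- `long 𝒪/𝔪 = 1`: the colength of the ideal of the origin is one. [folklore] -/
theorem colengthAtOrigin_origin : colengthAtOrigin (origin K) = 1 := by
  unfold colengthAtOrigin
  have h : ∀ N : ℕ, Module.length (A K) ((A K) ⧸ (origin K ⊔ origin K ^ (N + 1))) = 1 := fun N => by
    rw [sup_eq_left.mpr (Ideal.pow_le_self (Nat.succ_ne_zero N)), Module.length_eq_one_iff,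
      isSimpleModule_iff_isCoatom]
    exact Ideal.isMaximal_def.mp origin_isMaximal
  simp [h]

/-- `ν(s·y_i) = 1` for a non-zero scalar `s`. [folklore] -/
theorem ordZero_C_mul_X {s : K} (hs : s ≠ 0) (i : Fin 2) : ordZero (C s * X i : A K) = 1 := by
  classical
  rw [show (1 : ℕ∞) = ((1 : ℕ) : ℕ∞) from rfl, Hauser2010.ordZero_eq_nat_iff]
  refine ⟨⟨Finsupp.single i 1, ?_, by simp [Finsupp.degree_single]⟩, fun d hd => ?_⟩
  · rw [coeff_C_mul, coeff_X, if_pos rfl, mul_one]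
    exact hs
  · have hd0 : d = 0 := (Finsupp.degree_eq_zero_iff d).mp (Nat.lt_one_iff.mp hd)
    subst hd0
    rw [coeff_C_mul, coeff_zero_X, mul_zero]

/-- THE ANTELOPE SOURCE HAS `D(dF) = 𝔪`: for the pair `(y²z³(y+z)², y³z²(y+z)²)` the chosen finite part is the ideal
of the origin and both chosen cofactors are non-zero scalar multiples of `z` and `y`. [cite: Giraud1983, §2.1] -/
theorem antelopeForm_finitePart :
    finitePart (antelopeForm (K := K)).a (antelopeForm (K := K)).b = origin K ∧
    ∃ s : K, s ≠ 0 ∧ (finitePartGens (antelopeForm (K := K)).a (antelopeForm (K := K)).b).1 = C s * X 1 ∧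
      (finitePartGens (antelopeForm (K := K)).a (antelopeForm (K := K)).b).2 = C s * X 0 := by
  set a : A K := (antelopeForm (K := K)).a with ha
  set b : A K := (antelopeForm (K := K)).b with hb
  set h₀ : A K := X 0 ^ 2 * X 1 ^ 2 * (X 0 + X 1) ^ 2 with hh₀
  have h₀0 : h₀ ≠ 0 :=
    mul_ne_zero (mul_ne_zero (pow_ne_zero _ (X_ne_zero _)) (pow_ne_zero _ (X_ne_zero _)))
      (pow_ne_zero _ X_add_X_ne_zero)
  have ha' : a = h₀ * X 1 := by simp only [ha, hh₀, antelopeForm]; ring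
  have hb' : b = h₀ * X 0 := by simp only [hb, hh₀, antelopeForm]; ring
  obtain ⟨g', hg'⟩ := dvd_gcdPair (a := a) (b := b) ⟨X 1, ha'⟩ ⟨X 0, hb'⟩
  have h1 : g' * (finitePartGens a b).1 = X 1 := by
    have e1 : h₀ * (g' * (finitePartGens a b).1) = h₀ * X 1 :=
      calc h₀ * (g' * (finitePartGens a b).1) = gcdPair a b * (finitePartGens a b).1 := by rw [hg']; ring
        _ = a := gcdPair_mul_finitePartGens_fst a b
        _ = h₀ * X 1 := ha'
    exact mul_left_cancel₀ h₀0 e1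
  have h2 : g' * (finitePartGens a b).2 = X 0 := by
    have e2 : h₀ * (g' * (finitePartGens a b).2) = h₀ * X 0 :=
      calc h₀ * (g' * (finitePartGens a b).2) = gcdPair a b * (finitePartGens a b).2 := by rw [hg']; ring
        _ = b := gcdPair_mul_finitePartGens_snd a b
        _ = h₀ * X 0 := hb'
    exact mul_left_cancel₀ h₀0 e2
  -- `g'` is a unit: otherwise the first cofactor is a unit and `z ∣ g'`, so `z ∣ g'·c₂ = y`
  have hg'u : IsUnit g' := by
    rcases (irreducible_X (K := K) 1).isUnit_or_isUnit h1.symm with hu | hu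
    · exact hu
    · exfalso
      obtain ⟨u, hu⟩ := hu
      have hz : (X 1 : A K) ∣ g' := ⟨↑u⁻¹, by rw [← h1, ← hu, mul_assoc, Units.mul_inv, mul_one]⟩
      have hdiv : (X 1 : A K) ∣ X 0 := h2 ▸ dvd_mul_of_dvd_left hz _
      exact absurd (X_dvd_X.mp hdiv) (by decide)
  obtain ⟨s, hs, hgs⟩ := isUnit_iff_eq_C_of_isReduced.mp hg'u
  have hs0 : s ≠ 0 := hs.ne_zero
  have hc₁ : (finitePartGens a b).1 = C s⁻¹ * X 1 := by
    have e : C s⁻¹ * (g' * (finitePartGens a b).1) = C s⁻¹ * X 1 := by rw [h1]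
    rwa [hgs, ← mul_assoc, ← C_mul, inv_mul_cancel₀ hs0, C_1, one_mul] at e
  have hc₂ : (finitePartGens a b).2 = C s⁻¹ * X 0 := by
    have e : C s⁻¹ * (g' * (finitePartGens a b).2) = C s⁻¹ * X 0 := by rw [h2]
    rwa [hgs, ← mul_assoc, ← C_mul, inv_mul_cancel₀ hs0, C_1, one_mul] at e
  refine ⟨?_, s⁻¹, inv_ne_zero hs0, hc₁, hc₂⟩
  apply le_antisymm
  · unfold finitePart
    rw [Ideal.span_le]
    intro f hf
    simp only [Set.mem_insert_iff, Set.mem_singleton_iff] at hf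
    rcases hf with rfl | rfl
    · rw [hc₁]
      exact Ideal.mul_mem_left _ _ (Ideal.subset_span (by simp))
    · rw [hc₂]
      exact Ideal.mul_mem_left _ _ (Ideal.subset_span (by simp))
  · unfold origin
    rw [Ideal.span_le]
    intro f hf
    simp only [Set.mem_insert_iff, Set.mem_singleton_iff] at hf
    rcases hf with rfl | rfl
    · rw [SetLike.mem_coe, ← h2]
      exact Ideal.mul_mem_left _ _ (Ideal.subset_span (by simp))
    · rw [SetLike.mem_coe, ← h1]
      exact Ideal.mul_mem_left _ _ (Ideal.subset_span (by simp))

/-- `(μ, χ) = (1, 1)` FOR THE ANTELOPE FORM (any field): the reduced finite part is the maximal ideal of the origin,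
so Giraud's REDUCED invariant (Rem. 2.7) is already terminal at the kangaroo source. [cite: Giraud1983, §2.1, Rem. 2.7] -/
theorem antelopeForm_mu_chi : mu (antelopeForm (K := K)) = 1 ∧ chi (antelopeForm (K := K)) = 1 := by
  obtain ⟨hfp, s, hs, h1, h2⟩ := antelopeForm_finitePart (K := K)
  constructor
  · show mPair (antelopeForm (K := K)).a (antelopeForm (K := K)).b = 1
    unfold mPair
    rw [h1, h2, ordZero_C_mul_X hs, ordZero_C_mul_X hs, min_self]
  · show cPair (antelopeForm (K := K)).a (antelopeForm (K := K)).b = 1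
    unfold cPair
    rw [hfp]
    exact colengthAtOrigin_origin

/-! ## Soundness of the `(1, 1)` certificate

The kangaroo SOURCES carry `(μ, χ) = (1, 1)`: the reduced finite part is the maximal ideal of the point.  A certificate
for this: `(a, b) = h·(u₁, u₂)` with `u₁, u₂` relatively prime, both vanishing at the origin with order one, and
`y, z ∈ (u₁, u₂) + 𝔪²`.  Then the CHOSEN finite part `D` satisfies `D ⊆ 𝔪 ⊆ D + 𝔪²`, hence `D + 𝔪^{N+1} = 𝔪` for all
`N` (ideal arithmetic) and `c = long 𝒪/𝔪 = 1`, `m = 1`. -/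

/-- `𝔪 ⊆ I + 𝔪²` implies `𝔪 ⊆ I + 𝔪^{N+1}` for every `N`. [folklore] -/
theorem origin_le_sup_pow {I : Ideal (A K)} (h : origin K ≤ I ⊔ origin K ^ 2) :
    ∀ N : ℕ, origin K ≤ I ⊔ origin K ^ (N + 1)
  | 0 => by rw [zero_add, pow_one]; exact le_sup_right
  | N + 1 => by
    have ih := origin_le_sup_pow h N
    have h2 : origin K ^ 2 ≤ I ⊔ origin K ^ (N + 2) := by
      calc origin K ^ 2 = origin K * origin K := pow_two _
        _ ≤ origin K * (I ⊔ origin K ^ (N + 1)) := Ideal.mul_mono_right ih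
        _ = origin K * I ⊔ origin K * origin K ^ (N + 1) := Ideal.mul_sup _ _ _
        _ ≤ I ⊔ origin K ^ (N + 2) := sup_le_sup Ideal.mul_le_left (by rw [← pow_succ'])
    calc origin K ≤ I ⊔ origin K ^ 2 := h
      _ ≤ I ⊔ (I ⊔ origin K ^ (N + 2)) := sup_le_sup_left h2 _
      _ = I ⊔ origin K ^ (N + 2) := by rw [← sup_assoc, sup_idem]

/-- an ideal `I` with `I ⊆ 𝔪 ⊆ I + 𝔪²` has colength one at the origin. [folklore] -/
theorem colengthAtOrigin_eq_one {I : Ideal (A K)} (hI : I ≤ origin K) (h : origin K ≤ I ⊔ origin K ^ 2) :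
    colengthAtOrigin I = 1 := by
  unfold colengthAtOrigin
  have hN : ∀ N : ℕ, I ⊔ origin K ^ (N + 1) = origin K := fun N =>
    le_antisymm (sup_le hI (Ideal.pow_le_self (Nat.succ_ne_zero N))) (origin_le_sup_pow h N)
  have h1 : ∀ N : ℕ, Module.length (A K) ((A K) ⧸ (I ⊔ origin K ^ (N + 1))) = 1 := fun N => by
    rw [hN N, Module.length_eq_one_iff, isSimpleModule_iff_isCoatom]
    exact Ideal.isMaximal_def.mp origin_isMaximal
  simp [h1]

/-- under a certificate `(a, b) = h·(u₁, u₂)`, `h ≠ 0`, `u₁, u₂` relatively prime, the CHOSEN cofactors of the true gcd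
are a common non-zero scalar multiple of `(u₁, u₂)`. [cite: Giraud1983, §2.1 (2)] -/
theorem finitePartGens_of_certificate {a b h u₁ u₂ : A K} (hh : h ≠ 0) (ha : a = h * u₁) (hb : b = h * u₂)
    (hrel : IsRelPrime u₁ u₂) :
    ∃ s : K, s ≠ 0 ∧ (finitePartGens a b).1 = C s * u₁ ∧ (finitePartGens a b).2 = C s * u₂ := by
  obtain ⟨g', hg'⟩ := dvd_gcdPair (a := a) (b := b) ⟨u₁, ha⟩ ⟨u₂, hb⟩
  have h1 : g' * (finitePartGens a b).1 = u₁ := by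
    have e1 : h * (g' * (finitePartGens a b).1) = h * u₁ :=
      calc h * (g' * (finitePartGens a b).1) = gcdPair a b * (finitePartGens a b).1 := by rw [hg']; ring
        _ = a := gcdPair_mul_finitePartGens_fst a b
        _ = h * u₁ := ha
    exact mul_left_cancel₀ hh e1
  have h2 : g' * (finitePartGens a b).2 = u₂ := by
    have e2 : h * (g' * (finitePartGens a b).2) = h * u₂ :=
      calc h * (g' * (finitePartGens a b).2) = gcdPair a b * (finitePartGens a b).2 := by rw [hg']; ring
        _ = b := gcdPair_mul_finitePartGens_snd a b
        _ = h * u₂ := hb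
    exact mul_left_cancel₀ hh e2
  have hg'u : IsUnit g' := hrel (Dvd.intro _ h1) (Dvd.intro _ h2)
  obtain ⟨s, hs, hgs⟩ := isUnit_iff_eq_C_of_isReduced.mp hg'u
  have hs0 : s ≠ 0 := hs.ne_zero
  refine ⟨s⁻¹, inv_ne_zero hs0, ?_, ?_⟩
  · have e : C s⁻¹ * (g' * (finitePartGens a b).1) = C s⁻¹ * u₁ := by rw [h1]
    rwa [hgs, ← mul_assoc, ← C_mul, inv_mul_cancel₀ hs0, C_1, one_mul] at e
  · have e : C s⁻¹ * (g' * (finitePartGens a b).2) = C s⁻¹ * u₂ := by rw [h2]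
    rwa [hgs, ← mul_assoc, ← C_mul, inv_mul_cancel₀ hs0, C_1, one_mul] at e

/-- SOUNDNESS OF THE `c = 1` CERTIFICATE: `(a, b) = h·(u₁, u₂)`, `h ≠ 0`, `u₁, u₂` relatively prime and vanishing at the
origin, `y, z ∈ (u₁, u₂) + 𝔪²` ⟹ `c(I) = 1` for the true finite part. [cite: Giraud1983, §2.1 (2)–(3)] -/
theorem cPair_eq_one_of_certificate {a b h u₁ u₂ : A K} (hh : h ≠ 0) (ha : a = h * u₁) (hb : b = h * u₂)
    (hrel : IsRelPrime u₁ u₂) (hu₁ : constantCoeff u₁ = 0) (hu₂ : constantCoeff u₂ = 0)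
    (hX : ∀ i : Fin 2, (X i : A K) ∈ Ideal.span {u₁, u₂} ⊔ origin K ^ 2) : cPair a b = 1 := by
  obtain ⟨s, hs, h1, h2⟩ := finitePartGens_of_certificate hh ha hb hrel
  unfold cPair
  apply colengthAtOrigin_eq_one
  · unfold finitePart
    rw [Ideal.span_le]
    intro f hf
    simp only [Set.mem_insert_iff, Set.mem_singleton_iff] at hf
    rcases hf with rfl | rfl
    · exact mem_origin_of_constantCoeff_eq_zero (by rw [h1, map_mul, hu₁, mul_zero])
    · exact mem_origin_of_constantCoeff_eq_zero (by rw [h2, map_mul, hu₂, mul_zero])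
  · have hsu : Ideal.span {u₁, u₂} ≤ finitePart a b := by
      rw [Ideal.span_le]
      intro f hf
      simp only [Set.mem_insert_iff, Set.mem_singleton_iff] at hf
      have hCs : C s * C s⁻¹ = (1 : A K) := by rw [← C_mul, mul_inv_cancel₀ hs, C_1]
      rcases hf with rfl | rfl
      · have : f = C s⁻¹ * (finitePartGens a b).1 := by
          rw [h1, ← mul_assoc, mul_comm (C s⁻¹), hCs, one_mul]
        rw [SetLike.mem_coe, this]
        exact Ideal.mul_mem_left _ _ (Ideal.subset_span (by simp))
      · have : f = C s⁻¹ * (finitePartGens a b).2 := by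
          rw [h2, ← mul_assoc, mul_comm (C s⁻¹), hCs, one_mul]
        rw [SetLike.mem_coe, this]
        exact Ideal.mul_mem_left _ _ (Ideal.subset_span (by simp))
    unfold origin
    rw [Ideal.span_le]
    intro f hf
    simp only [Set.mem_insert_iff, Set.mem_singleton_iff] at hf
    rcases hf with rfl | rfl
    · exact sup_le_sup_right hsu _ (hX 0)
    · exact sup_le_sup_right hsu _ (hX 1)

/-- order one from coefficients: zero constant term and a non-zero linear coefficient. [folklore] -/
theorem ordZero_eq_one_of_coeff {u : A K} (h0 : constantCoeff u = 0) {i : Fin 2} (h1 : coeff (Finsupp.single i 1) u ≠ 0) :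
    ordZero u = 1 := by
  rw [show (1 : ℕ∞) = ((1 : ℕ) : ℕ∞) from rfl, Hauser2010.ordZero_eq_nat_iff]
  refine ⟨⟨Finsupp.single i 1, h1, by simp [Finsupp.degree_single]⟩, fun d hd => ?_⟩
  have hd0 : d = 0 := (Finsupp.degree_eq_zero_iff d).mp (Nat.lt_one_iff.mp hd)
  subst hd0
  exact h0

/-- `ν(s·u) = ν(u)` at a natural value, for a non-zero scalar `s`. [folklore] -/
theorem ordZero_C_mul_of_eq_nat {s : K} (hs : s ≠ 0) {u : A K} {n : ℕ} (hu : ordZero u = n) :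
    ordZero (C s * u) = n := by
  rw [Hauser2010.ordZero_eq_nat_iff] at hu ⊢
  obtain ⟨⟨d, hd, hdeg⟩, hlow⟩ := hu
  refine ⟨⟨d, ?_, hdeg⟩, fun d' hd' => ?_⟩
  · rw [coeff_C_mul]
    exact mul_ne_zero hs hd
  · rw [coeff_C_mul, hlow d' hd', mul_zero]

/-- SOUNDNESS OF THE `m = 1` CERTIFICATE: under the same factorisation with `ν(u₁) = ν(u₂) = 1`, `m(I) = 1` for the true
finite part. [cite: Giraud1983, §2.1 (3)] -/
theorem mPair_eq_one_of_certificate {a b h u₁ u₂ : A K} (hh : h ≠ 0) (ha : a = h * u₁) (hb : b = h * u₂)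
    (hrel : IsRelPrime u₁ u₂) (ho₁ : ordZero u₁ = 1) (ho₂ : ordZero u₂ = 1) : mPair a b = 1 := by
  obtain ⟨s, hs, h1, h2⟩ := finitePartGens_of_certificate hh ha hb hrel
  unfold mPair
  rw [h1, h2, show (1 : ℕ∞) = ((1 : ℕ) : ℕ∞) from rfl, ordZero_C_mul_of_eq_nat hs ho₁,
    ordZero_C_mul_of_eq_nat hs ho₂, min_self]

/-- SOUNDNESS OF THE `(μ, χ) = (1, 1)` CERTIFICATE for the reduced invariant of a form: the factorisation
`(ω_a, ω_b) = h·(u₁, u₂)` with `u₁, u₂` relatively prime of order one at the origin and `y, z ∈ (u₁, u₂) + 𝔪²` gives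
`(μ, χ) = (1, 1)` for the TRUE reduced finite part — the `Prop` reading of `certRed … = some (1, 1)` (the kangaroo
sources). [cite: Giraud1983, §2.1, Rem. 2.7] -/
theorem mu_chi_eq_one_of_certificate (ω : OneForm K) {h u₁ u₂ : A K} (hh : h ≠ 0) (ha : ω.a = h * u₁)
    (hb : ω.b = h * u₂) (hrel : IsRelPrime u₁ u₂) (hu₁ : constantCoeff u₁ = 0) (hu₂ : constantCoeff u₂ = 0)
    (ho₁ : ordZero u₁ = 1) (ho₂ : ordZero u₂ = 1) (hX : ∀ i : Fin 2, (X i : A K) ∈ Ideal.span {u₁, u₂} ⊔ origin K ^ 2) :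
    mu ω = 1 ∧ chi ω = 1 :=
  ⟨mPair_eq_one_of_certificate hh ha hb hrel ho₁ ho₂, cPair_eq_one_of_certificate hh ha hb hrel hu₁ hu₂ hX⟩

/-- the same for the logarithmic invariant `(m, c)` of 2.2. [cite: Giraud1983, §2.2] -/
theorem mLog_cLog_eq_one_of_certificate (E : Finset (Fin 2)) (ω : OneForm K) {h u₁ u₂ : A K} (hh : h ≠ 0)
    (ha : (logJacobianGens E ω).1 = h * u₁) (hb : (logJacobianGens E ω).2 = h * u₂) (hrel : IsRelPrime u₁ u₂)
    (hu₁ : constantCoeff u₁ = 0) (hu₂ : constantCoeff u₂ = 0) (ho₁ : ordZero u₁ = 1) (ho₂ : ordZero u₂ = 1)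
    (hX : ∀ i : Fin 2, (X i : A K) ∈ Ideal.span {u₁, u₂} ⊔ origin K ^ 2) : mLog E ω = 1 ∧ cLog E ω = 1 :=
  ⟨mPair_eq_one_of_certificate hh ha hb hrel ho₁ ho₂, cPair_eq_one_of_certificate hh ha hb hrel hu₁ hu₂ hX⟩

/-- `z` and `s·y` (`s ≠ 0`) are relatively prime. [folklore] -/
theorem isRelPrime_X_one_C_mul_X_zero {s : K} (hs : s ≠ 0) : IsRelPrime (X 1 : A K) (C s * X 0) := by
  intro d hd1 hd2
  obtain ⟨e, he⟩ := hd1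
  rcases (irreducible_X (K := K) 1).isUnit_or_isUnit he with hu | hu
  · exact hu
  · exfalso
    obtain ⟨u, hu⟩ := hu
    have hz : (X 1 : A K) ∣ d := ⟨↑u⁻¹, by rw [he, ← hu, mul_assoc, Units.mul_inv, mul_one]⟩
    have hprime : Prime (X 1 : A K) := MvPolynomial.X_prime
    rcases hprime.dvd_or_dvd (hz.trans hd2) with h | h
    · have hCu : IsUnit (C s : A K) := (MvPolynomial.isUnit_iff_eq_C_of_isReduced).mpr ⟨s, isUnit_iff_ne_zero.mpr hs, rfl⟩
      exact hprime.not_unit (isUnit_of_dvd_unit h hCu)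
    · exact absurd (X_dvd_X.mp h) (by decide)

/-- AN ATLAS KANGAROO SOURCE (p = 3, kernel row `edge_p3`): `F = y⁴z⁵ + y⁵z⁴` has, over any field of characteristic 3,
`dF = y³z³(z + 2y)·(z, 2y)` — a `(1, 1)` certificate: `(μ, χ) = (1, 1)` for the TRUE reduced finite part, by the soundness
theorem. [cite: Giraud1983, §2.1, Rem. 2.7] -/
theorem edgeP3_mu_chi [CharP K 3] :
    mu (dOf (X 0 ^ 4 * X 1 ^ 5 + X 0 ^ 5 * X 1 ^ 4 : A K)) = 1 ∧
      chi (dOf (X 0 ^ 4 * X 1 ^ 5 + X 0 ^ 5 * X 1 ^ 4 : A K)) = 1 := by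
  have h3 : (3 : A K) = 0 := by simpa using CharP.cast_eq_zero (A K) 3
  have h01 : (0 : Fin 2) ≠ 1 := by decide
  have h10 : (1 : Fin 2) ≠ 0 := by decide
  have h2K : (2 : K) ≠ 0 := by
    intro h2
    have h2' : ((2 : ℕ) : K) = 0 := by simpa using h2
    rw [CharP.cast_eq_zero_iff K 3] at h2'
    exact absurd h2' (by decide)
  have hh : (X 0 ^ 3 * X 1 ^ 3 * (X 1 + 2 * X 0) : A K) ≠ 0 := by
    refine mul_ne_zero (mul_ne_zero (pow_ne_zero _ (X_ne_zero _)) (pow_ne_zero _ (X_ne_zero _))) ?_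
    intro h
    have := congr_arg (eval ![(0 : K), 1]) h
    simp at this
  refine mu_chi_eq_one_of_certificate _ (h := X 0 ^ 3 * X 1 ^ 3 * (X 1 + 2 * X 0)) (u₁ := X 1) (u₂ := C 2 * X 0)
    hh ?_ ?_ (isRelPrime_X_one_C_mul_X_zero h2K) (constantCoeff_X K 1) (by simp [constantCoeff_X]) ?_
    (ordZero_C_mul_X h2K 0) ?_
  · simp only [dOf, map_add, Derivation.leibniz, Derivation.leibniz_pow, pderiv_X_self, pderiv_X_of_ne h01,
      pderiv_X_of_ne h10, smul_eq_mul, nsmul_eq_mul, Nat.cast_ofNat, mul_one, mul_zero, zero_add, add_zero]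
    linear_combination (X 0 ^ 3 * X 1 ^ 5 + X 0 ^ 4 * X 1 ^ 4) * h3
  · simp only [dOf, map_add, Derivation.leibniz, Derivation.leibniz_pow, pderiv_X_self, pderiv_X_of_ne h01,
      pderiv_X_of_ne h10, smul_eq_mul, nsmul_eq_mul, Nat.cast_ofNat, mul_one, mul_zero, zero_add, add_zero, map_ofNat]
    linear_combination (X 0 ^ 4 * X 1 ^ 4) * h3
  · have e : (X 1 : A K) = C 1 * X 1 := by rw [C_1, one_mul]
    rw [e]
    exact ordZero_C_mul_X one_ne_zero 1
  · intro i
    fin_cases i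
    · show (X 0 : A K) ∈ Ideal.span {X 1, C 2 * X 0} ⊔ origin K ^ 2
      have hC2 : (X 0 : A K) = C 2⁻¹ * (C 2 * X 0) := by
        rw [← mul_assoc, ← C_mul, inv_mul_cancel₀ h2K, C_1, one_mul]
      have hmem : C 2⁻¹ * (C 2 * X 0) ∈ Ideal.span ({X 1, C 2 * X 0} : Set (A K)) :=
        Ideal.mul_mem_left _ _ (Ideal.subset_span (by simp))
      rw [← hC2] at hmem
      exact Ideal.mem_sup_left hmem
    · show (X 1 : A K) ∈ Ideal.span {X 1, C 2 * X 0} ⊔ origin K ^ 2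
      exact Ideal.mem_sup_left (Ideal.subset_span (by simp))

/-! ## Soundness of the `¬(*)` certificate (three branches from a dividing line)

The kernel rows certify the failure of (*) at a Σ source by exhibiting a line `y + c·z`, `c ≠ 0`, dividing both
coefficients of `ω = dF` (conjuncts `peq (mul Q_A L) (dOf F).1`, `peq (mul Q_B L) (dOf F).2`), both axes being
exceptional.  At `Prop` level: such a line is a zero-divisor branch not associated to either axis, so
`ThreeBranchesAt0 univ ω` and (*) fails. -/

/-- `y + c·z ≠ 0`. [folklore] -/
theorem X_add_C_mul_X_ne_zero (c : K) : (X 0 + C c * X 1 : A K) ≠ 0 := fun h => by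
  have := congr_arg (eval ![(1 : K), 0]) h
  simp at this

/-- `y + c·z` is irreducible. [folklore] -/
theorem irreducible_X_add_C_mul_X (c : K) : Irreducible (X 0 + C c * X 1 : A K) := by
  have hhom : (X 0 + C c * X 1 : A K).IsHomogeneous 1 := by
    have h1 : (C c * X 1 : A K).IsHomogeneous (0 + 1) := (isHomogeneous_C (Fin 2) c).mul (isHomogeneous_X K 1)
    rw [zero_add] at h1
    exact (isHomogeneous_X K 0).add h1
  refine irreducible_of_totalDegree_eq_one (hhom.totalDegree (X_add_C_mul_X_ne_zero c)) (fun x hx => ?_)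
  by_cases hx0 : x = 0
  · exfalso
    apply X_add_C_mul_X_ne_zero (K := K) c
    ext m
    simpa [hx0] using hx m
  · exact isUnit_iff_ne_zero.mpr hx0

/-- `y + c·z`, `c ≠ 0`, is associated to neither axis. [folklore] -/
theorem not_associated_axis_line {c : K} (hc : c ≠ 0) (i : Fin 2) : ¬ Associated (X i : A K) (X 0 + C c * X 1) := by
  intro h
  have hXX : ∀ i j : Fin 2, (X i : A K) ∣ X j → i = j := fun i j h => X_dvd_X.mp h
  fin_cases i
  · have h' : (X 0 : A K) ∣ C c * X 1 := by
      have := dvd_sub h.dvd (dvd_refl (X 0))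
      rwa [add_sub_cancel_left] at this
    rcases (MvPolynomial.X_prime (i := (0 : Fin 2))).dvd_or_dvd h' with h'' | h''
    · have hCu : IsUnit (C c : A K) :=
        (MvPolynomial.isUnit_iff_eq_C_of_isReduced).mpr ⟨c, isUnit_iff_ne_zero.mpr hc, rfl⟩
      exact (MvPolynomial.X_prime (i := (0 : Fin 2))).not_unit (isUnit_of_dvd_unit h'' hCu)
    · exact absurd (hXX 0 1 h'') (by decide)
  · have h' : (X 1 : A K) ∣ X 0 := by
      have := dvd_sub h.dvd (dvd_mul_left (X 1 : A K) (C c))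
      rwa [add_sub_cancel_right] at this
    exact absurd (hXX 1 0 h') (by decide)

/-- SOUNDNESS OF THE `¬(*)` CERTIFICATE: with both axes exceptional, a line `y + c·z` (`c ≠ 0`) dividing both
coefficients of `ω` yields three pairwise non-associated branches of `E(d f_tot)` through the origin.
[cite: Giraud1983, §1.2 (*)] -/
theorem threeBranchesAt0_of_line {ω : OneForm K} {c : K} (hc : c ≠ 0) (ha : (X 0 + C c * X 1 : A K) ∣ ω.a)
    (hb : (X 0 + C c * X 1 : A K) ∣ ω.b) : ThreeBranchesAt0 Finset.univ ω := by
  have hXX : ∀ i j : Fin 2, (X i : A K) ∣ X j → i = j := fun i j h => X_dvd_X.mp h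
  have n01 : ¬ Associated (X 0 : A K) (X 1) := fun h => absurd (hXX 0 1 h.dvd) (by decide)
  have n0s := not_associated_axis_line (K := K) hc 0
  have n1s := not_associated_axis_line (K := K) hc 1
  have hbr : IsZeroDivisorBranch ω (X 0 + C c * X 1) :=
    ⟨irreducible_X_add_C_mul_X c, by simp, ha, hb⟩
  refine ⟨![X 0, X 1, X 0 + C c * X 1], ?_, ?_⟩
  · intro i
    fin_cases i
    · exact Or.inl ⟨0, Finset.mem_univ _, rfl⟩
    · exact Or.inl ⟨1, Finset.mem_univ _, rfl⟩
    · exact Or.inr hbr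
  · intro i j hij
    fin_cases i <;> fin_cases j
    all_goals first
      | exact absurd rfl hij
      | simpa using n01
      | simpa using n01 ∘ Associated.symm
      | simpa using n0s
      | simpa using n0s ∘ Associated.symm
      | simpa using n1s
      | simpa using n1s ∘ Associated.symm

/-- … hence (*) FAILS there — the `Prop` reading of the source-side kernel conjuncts of every Σ row.
[cite: Giraud1983, §1.2 (*)] -/
theorem not_starAt0_of_line {ω : OneForm K} {c : K} (hc : c ≠ 0) (ha : (X 0 + C c * X 1 : A K) ∣ ω.a)
    (hb : (X 0 + C c * X 1 : A K) ∣ ω.b) : ¬ StarAt0 Finset.univ ω :=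
  (threeBranchesAt0_of_line hc ha hb).not_starAt0

/-- AN ATLAS KANGAROO SOURCE (p = 3, kernel row `edge_p3`): (*) fails at `y⁴z⁵ + y⁵z⁴` with both axes exceptional —
the line `y + 2z` divides `dF`. [cite: Giraud1983, §1.2 (*)] -/
theorem edgeP3_not_starAt0 [CharP K 3] : ¬ StarAt0 Finset.univ (dOf (X 0 ^ 4 * X 1 ^ 5 + X 0 ^ 5 * X 1 ^ 4 : A K)) := by
  have h3 : (3 : A K) = 0 := by simpa using CharP.cast_eq_zero (A K) 3
  have h01 : (0 : Fin 2) ≠ 1 := by decide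
  have h10 : (1 : Fin 2) ≠ 0 := by decide
  have h2K : (2 : K) ≠ 0 := by
    intro h2
    have h2' : ((2 : ℕ) : K) = 0 := by simpa using h2
    rw [CharP.cast_eq_zero_iff K 3] at h2'
    exact absurd h2' (by decide)
  refine not_starAt0_of_line h2K ⟨2 * X 0 ^ 3 * X 1 ^ 4, ?_⟩ ⟨X 0 ^ 4 * X 1 ^ 3, ?_⟩
  · simp only [dOf, map_add, Derivation.leibniz, Derivation.leibniz_pow, pderiv_X_self, pderiv_X_of_ne h01,
      pderiv_X_of_ne h10, smul_eq_mul, nsmul_eq_mul, Nat.cast_ofNat, mul_one, mul_zero, zero_add, add_zero, map_ofNat]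
    linear_combination (X 0 ^ 4 * X 1 ^ 4) * h3
  · simp only [dOf, map_add, Derivation.leibniz, Derivation.leibniz_pow, pderiv_X_self, pderiv_X_of_ne h01,
      pderiv_X_of_ne h10, smul_eq_mul, nsmul_eq_mul, Nat.cast_ofNat, mul_one, mul_zero, zero_add, add_zero, map_ofNat]
    linear_combination (X 0 ^ 4 * X 1 ^ 4 + X 0 ^ 5 * X 1 ^ 3) * h3

/-! ## Proved identities of the dictionary (characteristic `p`) -/

section CharP

variable (p : ℕ) [CharP K p]

/-- `∂_i (G^p) = 0` in characteristic `p`. [folklore] -/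
theorem pderiv_pow_char_eq_zero (i : Fin 2) (G : A K) : pderiv i (G ^ p) = 0 := by
  rw [(pderiv i).leibniz_pow, nsmul_eq_mul, CharP.cast_eq_zero (A K) p, zero_mul]

/-- the differential is blind to `p`-th powers: `d(F + G^p) = dF`; in particular Giraud's invariants of `dF` do not
see the atlas' cleaning `x ↦ x + G` of `x^p + F`. [folklore] -/
theorem pderiv_add_pow_char (i : Fin 2) (F G : A K) : pderiv i (F + G ^ p) = pderiv i F := by
  rw [map_add, pderiv_pow_char_eq_zero p i G, add_zero]

/-- the two exact forms `d(F)` and `d(F + G^p)` coincide. [folklore] -/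
theorem dOf_add_pow_char (F G : A K) : dOf (F + G ^ p) = dOf F := by
  simp only [dOf, pderiv_add_pow_char p]

/-- `∂_i (y_j^p · G) = y_j^p · ∂_i G`: the total transform `f ∘ e = y_j^p · F'` (F' the atlas' strict transform) has
`d(f ∘ e) = y_j^p · dF'`, so the two log-Jacobian ideals differ by the invertible ideal `(y_j^p)` and Giraud's
`m`, `c` (2.1: invariant under such a multiplication) are read off the atlas state. [folklore] -/
theorem pderiv_X_pow_char_mul (i j : Fin 2) (G : A K) :
    pderiv i (X j ^ p * G) = X j ^ p * pderiv i G := by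
  rw [Derivation.leibniz, pderiv_pow_char_eq_zero p i (X j), smul_zero, add_zero, smul_eq_mul]

/-- more generally for a `p`-th power monomial factor `M = (y^α z^β)^p`: `d(M·G) = M·dG`. [folklore] -/
theorem pderiv_pow_char_mul (i : Fin 2) (M G : A K) :
    pderiv i (M ^ p * G) = M ^ p * pderiv i G := by
  rw [Derivation.leibniz, pderiv_pow_char_eq_zero p i M, smul_zero, add_zero, smul_eq_mul]

/-- in characteristic 2 the differential of Hauser's antelope `y⁵z³ + y³z⁵` IS `antelopeForm`:
`F_y = 5y⁴z³ + 3y²z⁵ = y²z³(y+z)²`, `F_z = 3y⁵z² + 5y³z⁴ = y³z²(y+z)²`. [folklore] -/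
theorem dOf_antelope_char_two [CharP K 2] :
    dOf (X 0 ^ 5 * X 1 ^ 3 + X 0 ^ 3 * X 1 ^ 5 : A K) = antelopeForm := by
  have h2 : (2 : A K) = 0 := by simpa using CharP.cast_eq_zero (A K) 2
  have h01 : (0 : Fin 2) ≠ 1 := by decide
  have h10 : (1 : Fin 2) ≠ 0 := by decide
  simp only [dOf, antelopeForm, OneForm.mk.injEq, map_add, Derivation.leibniz, Derivation.leibniz_pow,
    pderiv_X_self, pderiv_X_of_ne h01, pderiv_X_of_ne h10, smul_eq_mul, nsmul_eq_mul, Nat.cast_ofNat,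
    mul_one, mul_zero, zero_add, add_zero]
  constructor
  · linear_combination (2 * X 0 ^ 4 * X 1 ^ 3 - X 0 ^ 3 * X 1 ^ 4 + X 0 ^ 2 * X 1 ^ 5) * h2
  · linear_combination (X 0 ^ 5 * X 1 ^ 2 - X 0 ^ 4 * X 1 ^ 3 + 2 * X 0 ^ 3 * X 1 ^ 4) * h2

/-- so, over any field of characteristic 2, (*) FAILS at Hauser's antelope read through `d f_tot` with both axes
exceptional — the `Prop`-level counterpart of the kernel row `antelope_form`. [cite: Giraud1983, §1.2 (*)] -/
theorem antelope_not_starAt0 [CharP K 2] :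
    ¬ StarAt0 Finset.univ (dOf (X 0 ^ 5 * X 1 ^ 3 + X 0 ^ 3 * X 1 ^ 5 : A K)) := by
  rw [dOf_antelope_char_two]
  exact antelopeForm_not_starAt0

/-- in characteristic 2 the differential of the kangaroo target `y⁶(z³ + z⁵)` IS `kangarooForm`:
`F_y = 6y⁵(z³+z⁵) = 0`, `F_z = 3y⁶z² + 5y⁶z⁴ = y⁶z²(1+z)²`. [folklore] -/
theorem dOf_kangaroo_char_two [CharP K 2] :
    dOf (X 0 ^ 6 * X 1 ^ 3 + X 0 ^ 6 * X 1 ^ 5 : A K) = kangarooForm := by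
  have h2 : (2 : A K) = 0 := by simpa using CharP.cast_eq_zero (A K) 2
  have h01 : (0 : Fin 2) ≠ 1 := by decide
  have h10 : (1 : Fin 2) ≠ 0 := by decide
  simp only [dOf, kangarooForm, OneForm.mk.injEq, map_add, Derivation.leibniz, Derivation.leibniz_pow,
    pderiv_X_self, pderiv_X_of_ne h01, pderiv_X_of_ne h10, smul_eq_mul, nsmul_eq_mul, Nat.cast_ofNat,
    mul_one, mul_zero, zero_add, add_zero]
  constructor
  · linear_combination (3 * X 0 ^ 5 * X 1 ^ 3 + 3 * X 0 ^ 5 * X 1 ^ 5) * h2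
  · linear_combination (X 0 ^ 6 * X 1 ^ 2 - X 0 ^ 6 * X 1 ^ 3 + 2 * X 0 ^ 6 * X 1 ^ 4) * h2

/-- (**) HOLDS AT HAUSER'S KANGAROO TARGET read through `d f_tot` (new exceptional axis `y`), over any field of
characteristic 2: Giraud's logarithmic invariant is already terminal at the point where Hauser's shade rose —
the `Prop`-level counterpart of the kernel row `kangaroo_form`. [cite: Giraud1983, §1.2 (**), §2.2] -/
theorem kangaroo_doubleStarAt0 [CharP K 2] :
    DoubleStarAt0 {0} (dOf (X 0 ^ 6 * X 1 ^ 3 + X 0 ^ 6 * X 1 ^ 5 : A K)) := by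
  rw [dOf_kangaroo_char_two]
  exact kangarooForm_doubleStarAt0

/-- `(m, c) = (0, 0)` at Hauser's kangaroo target read through `d f_tot`, characteristic 2 — the `Prop`-level value of
the kernel certificate `certLog 2 60 [true, false] … = some (0, 0)` of row `kangaroo_form`. [cite: Giraud1983, §2.2] -/
theorem kangaroo_mLog_cLog [CharP K 2] :
    mLog {0} (dOf (X 0 ^ 6 * X 1 ^ 3 + X 0 ^ 6 * X 1 ^ 5 : A K)) = 0 ∧
      cLog {0} (dOf (X 0 ^ 6 * X 1 ^ 3 + X 0 ^ 6 * X 1 ^ 5 : A K)) = 0 := by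
  rw [dOf_kangaroo_char_two]
  exact kangarooForm_mLog_cLog

/-- `(μ, χ) = (1, 1)` at Hauser's kangaroo SOURCE `y⁵z³ + y³z⁵` read through `dF`, characteristic 2 — the
`Prop`-level value of the kernel certificate `certRed 2 60 … = some (1, 1)` of row `antelope_form`: the reduced
invariant is terminal at the source (and at the target), so it cannot detect the kangaroo; (*) does
(`antelope_not_starAt0`). [cite: Giraud1983, §2.1, Rem. 2.7] -/
theorem antelope_mu_chi [CharP K 2] :
    mu (dOf (X 0 ^ 5 * X 1 ^ 3 + X 0 ^ 3 * X 1 ^ 5 : A K)) = 1 ∧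
      chi (dOf (X 0 ^ 5 * X 1 ^ 3 + X 0 ^ 3 * X 1 ^ 5 : A K)) = 1 := by
  rw [dOf_antelope_char_two]
  exact antelopeForm_mu_chi

/-- `(μ, χ) = (0, 0)` at Hauser's kangaroo TARGET read through `dF'`, characteristic 2. [cite: Giraud1983, §2.1, Rem. 2.7] -/
theorem kangaroo_mu_chi [CharP K 2] :
    mu (dOf (X 0 ^ 6 * X 1 ^ 3 + X 0 ^ 6 * X 1 ^ 5 : A K)) = 0 ∧
      chi (dOf (X 0 ^ 6 * X 1 ^ 3 + X 0 ^ 6 * X 1 ^ 5 : A K)) = 0 := by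
  rw [dOf_kangaroo_char_two]
  exact kangarooForm_mu_chi

/-- HAUSER'S KANGAROO EDGE READ BY GIRAUD, assembled (characteristic 2; source `F = y⁵z³ + y³z⁵` with both axes
exceptional, target `F' = y⁶(z³ + z⁵)` with the new axis `y` exceptional, read through `ω = dF`):
at the SOURCE condition (*) of 1.2 fails while the reduced invariant is `(μ, χ) = (1, 1)`; at the TARGET — where
Hauser's shade has risen — (**) holds with `(m, c) = (0, 0)` and `(μ, χ) = (0, 0)`.  The four numbers are the values the
computable twin `KangarooAtlasCert.GiraudForm` certifies by `decide` (rows `antelope_form`, `kangaroo_form`).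
[cite: Giraud1983, §1.2 (*), (**), §2.1, §2.2, Rem. 2.7] -/
theorem hauserKangaroo_giraudReading [CharP K 2] :
    (¬ StarAt0 Finset.univ (dOf (X 0 ^ 5 * X 1 ^ 3 + X 0 ^ 3 * X 1 ^ 5 : A K)) ∧
      mu (dOf (X 0 ^ 5 * X 1 ^ 3 + X 0 ^ 3 * X 1 ^ 5 : A K)) = 1 ∧
      chi (dOf (X 0 ^ 5 * X 1 ^ 3 + X 0 ^ 3 * X 1 ^ 5 : A K)) = 1) ∧
    (DoubleStarAt0 {0} (dOf (X 0 ^ 6 * X 1 ^ 3 + X 0 ^ 6 * X 1 ^ 5 : A K)) ∧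
      mLog {0} (dOf (X 0 ^ 6 * X 1 ^ 3 + X 0 ^ 6 * X 1 ^ 5 : A K)) = 0 ∧
      cLog {0} (dOf (X 0 ^ 6 * X 1 ^ 3 + X 0 ^ 6 * X 1 ^ 5 : A K)) = 0 ∧
      mu (dOf (X 0 ^ 6 * X 1 ^ 3 + X 0 ^ 6 * X 1 ^ 5 : A K)) = 0 ∧
      chi (dOf (X 0 ^ 6 * X 1 ^ 3 + X 0 ^ 6 * X 1 ^ 5 : A K)) = 0) :=
  ⟨⟨antelope_not_starAt0, antelope_mu_chi⟩,
    ⟨kangaroo_doubleStarAt0, kangaroo_mLog_cLog.1, kangaroo_mLog_cLog.2, kangaroo_mu_chi⟩⟩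

/-- AN ATLAS KANGAROO SOURCE at `p = 3` (kernel row `edge_p3`, `F = y⁴z⁵ + y⁵z⁴`), assembled: (*) fails and
`(μ, χ) = (1, 1)` — the signature Σ of the cell's census on the source side, at `Prop` level. [cite: Giraud1983, §1.2 (*), §2.1, Rem. 2.7] -/
theorem edgeP3_source_giraudReading [CharP K 3] :
    ¬ StarAt0 Finset.univ (dOf (X 0 ^ 4 * X 1 ^ 5 + X 0 ^ 5 * X 1 ^ 4 : A K)) ∧
      mu (dOf (X 0 ^ 4 * X 1 ^ 5 + X 0 ^ 5 * X 1 ^ 4 : A K)) = 1 ∧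
      chi (dOf (X 0 ^ 4 * X 1 ^ 5 + X 0 ^ 5 * X 1 ^ 4 : A K)) = 1 :=
  ⟨edgeP3_not_starAt0, edgeP3_mu_chi⟩

/-- THE TARGET of the `p = 3` atlas kangaroo edge `edge_p3`: `F' = y⁶z² + y⁶z⁵` (new axis `y` exceptional), over any
field of characteristic 3: `dF' = (0, 2y⁶z(1 + z³)) = axisForm 6 1 (2(1 + z³))`. [folklore] -/
theorem dOf_edgeP3Target_char_three [CharP K 3] :
    dOf (X 0 ^ 6 * X 1 ^ 2 + X 0 ^ 6 * X 1 ^ 5 : A K) = axisForm 6 1 (2 * (1 + X 1 ^ 3)) := by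
  have h3 : (3 : A K) = 0 := by simpa using CharP.cast_eq_zero (A K) 3
  have h01 : (0 : Fin 2) ≠ 1 := by decide
  have h10 : (1 : Fin 2) ≠ 0 := by decide
  simp only [dOf, axisForm, OneForm.mk.injEq, map_add, Derivation.leibniz, Derivation.leibniz_pow,
    pderiv_X_self, pderiv_X_of_ne h01, pderiv_X_of_ne h10, smul_eq_mul, nsmul_eq_mul, Nat.cast_ofNat,
    mul_one, mul_zero, zero_add, add_zero]
  constructor
  · linear_combination (2 * X 0 ^ 5 * X 1 ^ 2 + 2 * X 0 ^ 5 * X 1 ^ 5) * h3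
  · linear_combination (X 0 ^ 6 * X 1 ^ 4) * h3

/-- … hence at that TARGET (**) holds with `(m, c) = (0, 0)` and `(μ, χ) = (0, 0)` — the `Prop`-level values of the
kernel row `edge_p3` (`certLog … = some (0, 0)`). [cite: Giraud1983, §1.2 (**), §2.1, §2.2, Rem. 2.7] -/
theorem edgeP3_target_giraudReading [CharP K 3] :
    DoubleStarAt0 {0} (dOf (X 0 ^ 6 * X 1 ^ 2 + X 0 ^ 6 * X 1 ^ 5 : A K)) ∧
      mLog {0} (dOf (X 0 ^ 6 * X 1 ^ 2 + X 0 ^ 6 * X 1 ^ 5 : A K)) = 0 ∧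
      cLog {0} (dOf (X 0 ^ 6 * X 1 ^ 2 + X 0 ^ 6 * X 1 ^ 5 : A K)) = 0 ∧
      mu (dOf (X 0 ^ 6 * X 1 ^ 2 + X 0 ^ 6 * X 1 ^ 5 : A K)) = 0 ∧
      chi (dOf (X 0 ^ 6 * X 1 ^ 2 + X 0 ^ 6 * X 1 ^ 5 : A K)) = 0 := by
  have h2K : (2 : K) ≠ 0 := by
    intro h2
    have h2' : ((2 : ℕ) : K) = 0 := by simpa using h2
    rw [CharP.cast_eq_zero_iff K 3] at h2'
    exact absurd h2' (by decide)
  have hu : constantCoeff (2 * (1 + X 1 ^ 3) : A K) ≠ 0 := by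
    simpa [constantCoeff_X, map_ofNat] using h2K
  rw [dOf_edgeP3Target_char_three]
  exact axisForm_giraudReading 6 le_rfl hu

/-- AN ATLAS KANGAROO EDGE READ BY GIRAUD, assembled (`p = 3`, kernel row `edge_p3`: source `y⁴z⁵ + y⁵z⁴` with both
axes exceptional → chart `y`, point `t = 1` on the third branch `y + 2z` → target `y⁶z² + y⁶z⁵`, Hauser's shade rises):
SOURCE ¬(*) with `(μ, χ) = (1, 1)`; TARGET (**) with `(m, c) = (0, 0)`, `(μ, χ) = (0, 0)`.
[cite: Giraud1983, §1.2 (*), (**), §2.1, §2.2, Rem. 2.7] -/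
theorem edgeP3_giraudReading [CharP K 3] :
    (¬ StarAt0 Finset.univ (dOf (X 0 ^ 4 * X 1 ^ 5 + X 0 ^ 5 * X 1 ^ 4 : A K)) ∧
      mu (dOf (X 0 ^ 4 * X 1 ^ 5 + X 0 ^ 5 * X 1 ^ 4 : A K)) = 1 ∧
      chi (dOf (X 0 ^ 4 * X 1 ^ 5 + X 0 ^ 5 * X 1 ^ 4 : A K)) = 1) ∧
    (DoubleStarAt0 {0} (dOf (X 0 ^ 6 * X 1 ^ 2 + X 0 ^ 6 * X 1 ^ 5 : A K)) ∧
      mLog {0} (dOf (X 0 ^ 6 * X 1 ^ 2 + X 0 ^ 6 * X 1 ^ 5 : A K)) = 0 ∧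
      cLog {0} (dOf (X 0 ^ 6 * X 1 ^ 2 + X 0 ^ 6 * X 1 ^ 5 : A K)) = 0 ∧
      mu (dOf (X 0 ^ 6 * X 1 ^ 2 + X 0 ^ 6 * X 1 ^ 5 : A K)) = 0 ∧
      chi (dOf (X 0 ^ 6 * X 1 ^ 2 + X 0 ^ 6 * X 1 ^ 5 : A K)) = 0) :=
  ⟨edgeP3_source_giraudReading, edgeP3_target_giraudReading⟩

end CharP

/-! ## Elementary facts about the typed objects -/

/-- with `E = ∅` the logarithmic ideal is the coefficient ideal (1.1 (4): `J(X,f) = J(X,f,∅)`). [cite: Giraud1983, §1.1 (4)] -/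
theorem logJacobianGens_empty (ω : OneForm K) : logJacobianGens ∅ ω = (ω.a, ω.b) := by
  simp [logJacobianGens]

/-- `J(X, ω, ∅) = J(X, ω)` (1.1 (4)). [cite: Giraud1983, §1.1 (4)] -/
theorem logJacobianIdeal_empty (ω : OneForm K) : logJacobianIdeal ∅ ω = coeffIdeal ω := by
  simp [logJacobianIdeal, logJacobianGens, coeffIdeal]

/-- with both axes in `E` the generators are `(y·a, z·b)`. [cite: Giraud1983, §1.1] -/
theorem logJacobianGens_univ (ω : OneForm K) : logJacobianGens Finset.univ ω = (X 0 * ω.a, X 1 * ω.b) := by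
  simp [logJacobianGens]

/-- (**) implies (*) (by definition). [cite: Giraud1983, §1.2] -/
theorem DoubleStarAxesAt0.star {E : Finset (Fin 2)} {ω : OneForm K} (h : DoubleStarAxesAt0 E ω) :
    StarAxesAt0 E ω := h.1

/-- a point of `Sing` is not a point where (**) holds. [cite: Giraud1983, §2.2] -/
theorem InSing.not_doubleStar {E : Finset (Fin 2)} {ω : OneForm K} (h : InSing E ω) : ¬ DoubleStarAxesAt0 E ω :=
  fun h' => h.2 h'.2

end Literature.AlgebraicGeometry.Resolution.Giraud1983
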